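import Literature.NumberTheory.LFunctions.UniformClassGroupZeroSum
import Literature.NumberTheory.LFunctions.ClassGroupExplicitFormula
import Literature.NumberTheory.LFunctions.UniformClassGroupPNTGeneralDegreeInputs
import Literature.NumberTheory.LFunctions.ClassGroupLFunctionLogDerivLeft
import Literature.NumberTheory.LFunctions.ClassGroupSmoothedPsi
import Literature.NumberTheory.LFunctions.ClassGroupExplicitFormulaBounds
import Literature.NumberTheory.LFunctions.ClassGroupPsiErrorTerm
import Literature.NumberTheory.LFunctions.ClassGroupLFunctionExceptionalZero
import Literature.NumberTheory.LFunctions.UniformClassGroupPNTReduction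
import Literature.NumberTheory.LFunctions.ClassGroupLFunctionExceptionalZeroEffective
import Literature.NumberTheory.LFunctions.DedekindZetaExplicitFormula
import Mathlib.Analysis.SpecialFunctions.Pow.Real
import Mathlib.Analysis.SpecialFunctions.Log.Basic
import Mathlib.Analysis.SpecialFunctions.Sqrt
import Mathlib.Analysis.Complex.ExponentialBounds
import HarnessLib

/-!
# The class prime number theorem for a number field of fixed degree, smoothed, with the Deuring–Heilbronn phenomenon and decaying error (Thorner–Zaman 2019 §§3–5; re-homed proofs)

**The class prime number theorem for the ideal classes of a number field of fixed degree, GRH-free and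
Siegel-free, in SMOOTHED form with the Deuring–Heilbronn phenomenon and a DECAYING relative error** — the analytic
core of J. Thorner, A. Zaman, *A unified and improved Chebotarev density theorem*, Algebra Number Theory 13 (2019)
1039–1068 [ThornerZaman2019], Thm. 1.4 / Thm. 5.1 with Thm. 3.1 (Landau–Page), Thm. 3.2 (log-free zero density)
and §§4.3–5 (zero sums against the weight, Deuring–Heilbronn), specialised to the family `{ζ_K} ∪ {L(s, χ)}_{χ ∈ Ĉl_K,
χ ≠ 1}` of class group `L`-functions (`L = H_K`, the Hilbert class field); cf. J. C. Lagarias, H. L. Montgomery,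
A. M. Odlyzko, Invent. Math. 54 (1979) §§5–7 [LagariasMontgomeryOdlyzko1979], A. Weiss, J. reine angew. Math. 338 (1983)
[Weiss1983], H. M. Stark, Invent. Math. 23 (1974) [Stark1974].  RE-HOMED into `Literature/` by the Hodge foundations lane
(`lit-hodgefound`, seat p20, generation 37): verbatim DECLARATION-LEVEL ports (the declarations needed downstream, in
dependency order, each with its original module docstring) of the theorem-only modules
`Summits/QuantumAdvantage/QuantumAdvantage/Theorems/LinnikCubicClassGroupsDegreeOnePrimesEscape{PerCharacterDeficitZeroSum (1
declaration), PerCharacterDeficitSmoothedBound (6), ClassPNTFamilyZeroSumZFR, ClassPNTSmoothed, LowerPITSmoothedAux (2),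
ClassPNTSmoothedMain (3), ClassPNTDHSmoothedDecayCore, ClassPNTDHInputs, ClassPNTDHSmoothedDecayPrelims, ClassPNTDHNumerics (1),
ClassPNTDecayNumerics (6)}.lean` (route cell `LinnikCubicClassGroups`, where they certified classical analytic number theory
independent of that route's hypothesis-type crux), namespace `Summit.QuantumAdvantage.QuantumAdvantage.Theorems.DegreeOnePrimesEscape`
re-rooted as `Literature.NumberTheory.LFunctions.NumberField.ClassPNT`.  Everything here is built on the tree's Literature layer
`Literature/NumberTheory/LFunctions/` (explicit formulae `ClassGroupExplicitFormula*`, `DedekindZetaExplicitFormula`, the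
Thorner–Zaman weight `TZWeight`, log-free density `ClassGroupLogFreeTheorem14AllDegrees` / `DedekindZeta1LogFreeTheorem14*`,
exceptional zeros `ClassGroupLFunctionExceptionalZero*`, Deuring–Heilbronn `DeuringHeilbronn`, zero sums `UniformClassGroupZeroSum`).

CONTENT (Part headers carry the details; `Q = condQn K = |d_K| nⁿ`, `g_x = tzTest (log x) x^{−ν}`, `F_x` its Laplace transform,
`h = h_K`): zero sums of one `L`-function and of the whole family over the non-real / off-segment zeros from an abstract
log-free density bound and a zero-free region given as a PARAMETER (so that the Deuring–Heilbronn constant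
`c_Z ≍ log(1/((1 − β₁) log x))/n` can be fed in); the explicit formulae of the family read two-sidedly with the exceptional
zeros kept; the Landau–Page package in `Q`-form; the smoothed dichotomy `‖h ψ̃_C(g_x) − F_x(−1) [+ ψ₁(C⁻¹) F_x(−β₁)]‖ ≤ η x`;
the core estimate with `c_Z` as a parameter; Stark's bound `c₁(n) Q^{−2} ≤ 1 − β₁`; and the real-variable bookkeeping of the
decay shape `𝓓_κ(x) = e^{−κ log x / log Q} + e^{−√(κ log x)}`.  Theorem-only file: no definition, no named fact (D-0026);
imports Mathlib/Literature only; every declaration carries the citation of the printed step it formalises or serves.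
Consumed by `ClassGroupPNTThornerZamanForm.lean` (same directory), which reaches the `θ_C`-form of [ThornerZaman2019, Thm. 1.4]
and discharges the named fact `ThornerZaman2019_classPNT_imaginaryQuadratic`.  The Summits originals stay in place (transitional
duplication; twins = same short names in `Summit.QuantumAdvantage.QuantumAdvantage.Theorems.DegreeOnePrimesEscape`).  Nothing here
bears on any summit statement.
-/

noncomputable section

/-!
## Part 1 — port of `Summits/QuantumAdvantage/QuantumAdvantage/Theorems/LinnikCubicClassGroupsDegreeOnePrimesEscapePerCharacterDeficitZeroSum.lean` (1 declarations kept)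

# The zero sum of ONE class group `L`-function over its NON-REAL zeros, against the
# Thorner–Zaman weight, from an abstract log-free density bound and a zero-free region

This is the single-character, general-degree twin of the tree's family file
`UniformClassGroupZeroSum.lean` (imaginary quadratic fields, whole family `Ĉl_K`): for a number
field `K` of degree `n > 1`, ONE character `χ ≠ 1` of `Cl_K`, the weight `g = tzTest (log x) ε`
(`x^{−ν} ≤ ε ≤ 1`) and its Laplace transform `F`, the zero terms of the explicit formula over the
NON-REAL non-trivial zeros satisfy

  `Σ_{ρ ∈ u, Im ρ ≠ 0} m(ρ) ‖F(−ρ)‖ ≤ A₀ x (e^{−cL/(4a log Q)} + e^{−√(cL/4)}) + A₀ x^{1−ν}`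

(`zeroSum_nonreal_le`), `Q = condQn K`, `L = log x ≥ a₀ log Q`, GIVEN (as hypotheses on `χ`)
the zero-free region `β ≤ 1 − c/(a log Q + log(|γ| + 4))` for the non-real zeros and the log-free
density bound `Σ_{|γ| ≤ T, β ≥ α} m ≤ D e^{b(a log Q + log(T + 4))(1 − α)}`. The real zeros are
simply EXCLUDED (the set `Exc` of `EntireEF.sum_zeroTerm_le`): in the one-sided application they
are dropped by sign. Ingredients: `EntireEF.sum_zeroTerm_le`,
`LinnikZeroSum.sum_rpow_div_le_of_density_zfr`, `sum_mult_le_of_window`, `junk_le` (all in tree).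
-/

section Part1

open _root_.Complex _root_.Real _root_.MeasureTheory _root_.Set _root_.Filter _root_.Topology
open scoped _root_.NumberField nonZeroDivisors
open Literature.NumberTheory.LFunctions Literature.NumberTheory.LFunctions.NumberField
  Literature.NumberTheory.LFunctions.EntireEF Literature.NumberTheory.LFunctions.TZWeight

namespace Literature.NumberTheory.LFunctions.NumberField.ClassPNT

/-! ### The finite part, one entire function -/

/-- The window data of `L₀(·,χ)` in general degree: `A = log|d_K| + 3n ≤ 4Q − 1`, `Q = condQn K`
(`log|d_K| ≤ |d_K| − 1 ≤ Q − 1`, `n ≤ Q`).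
[cite: ThornerZaman2019, §4.3 Lemmas 4.5–4.6 (zero sums of one L-function against the weight, non-real zeros)] -/
theorem windowConst_le_condQn (K : Type) [Field K] [NumberField K] :
    Real.log ((NumberField.discr K).natAbs : ℝ) + 3 * Module.finrank ℚ K ≤
      4 * ThornerZaman.condQn K := by
  have hd1 : (1 : ℝ) ≤ ((NumberField.discr K).natAbs : ℝ) := by
    have h1 : 1 ≤ (NumberField.discr K).natAbs :=
      Nat.one_le_iff_ne_zero.2 (Int.natAbs_ne_zero.2 (NumberField.discr_ne_zero K))
    exact_mod_cast h1
  have hlog := Real.log_le_sub_one_of_pos (by linarith : (0:ℝ) < ((NumberField.discr K).natAbs : ℝ))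
  have hn := ThornerZaman.finrank_le_condQn (K := K)
  have hdQ : ((NumberField.discr K).natAbs : ℝ) ≤ ThornerZaman.condQn K := by
    rw [ThornerZaman.condQn, Nat.cast_natAbs, Int.cast_abs]
    have hn1 : (1 : ℝ) ≤ (Module.finrank ℚ K : ℝ) ^ Module.finrank ℚ K := by
      have : (1 : ℝ) ≤ Module.finrank ℚ K := by
        exact_mod_cast Module.finrank_pos (R := ℚ) (M := K)
      exact one_le_pow₀ this
    nlinarith [abs_nonneg ((NumberField.discr K : ℝ))]
  linarith

end Literature.NumberTheory.LFunctions.NumberField.ClassPNT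

end Part1

/-!
## Part 2 — port of `Summits/QuantumAdvantage/QuantumAdvantage/Theorems/LinnikCubicClassGroupsDegreeOnePrimesEscapePerCharacterDeficitSmoothedBound.lean` (6 declarations kept)

# The smoothed character sum is one-sidedly small: `Re Σ_n Λ_χ(n) g_x(log n) ≤ η x`

Assembly of the two analytic bricks: the zero sum over the NON-REAL zeros of `L₀(·,χ)` from an
abstract log-free density bound plus the field-uniform zero-free region of the tree
(`zeroSum_nonreal_le`, `exists_zeroFree_classGroupLFunction₀`), and the explicit formula with the
REAL zeros dropped by sign (`re_coefFordK_tzTest_le`), together with the tree's bounds for the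
secondary terms (`analyticOrderNatAt_classGroupLFunction₀_zero_le`, `norm_cgEFRemainder_tzTest_zero_le`).
Result (`re_coefFordK_tzTest_le_mul`): for every `η > 0` there are `ν ∈ (0, 1/64]` and `a₁` (depending
on the degree `n`, the density constants and `η`) such that for every `K` of degree `n`, every
`χ ≠ 1` satisfying the density bound and every `x ≥ Q^{a₁}` (`Q = condQn K`):

  `Re Σ_n Λ_χ(n) g(log n) ≤ η x`,   `g = tzTest (log x) x^{−ν}`.
-/

section Part2

open _root_.Complex _root_.Real _root_.MeasureTheory _root_.Set _root_.Filter _root_.Topology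
open scoped _root_.NumberField nonZeroDivisors
open Literature.NumberTheory.LFunctions Literature.NumberTheory.LFunctions.NumberField
  Literature.NumberTheory.LFunctions.EntireEF Literature.NumberTheory.LFunctions.TZWeight

namespace Literature.NumberTheory.LFunctions.NumberField.ClassPNT

/-! ### Elementary facts -/

/-- `|d_K| ≤ Q = |d_K| n^n`.
[cite: ThornerZaman2019, §5 proof of Thm. 5.1 (smoothed character sums Σ Λ_χ(n) g(log n); one-sided form)] -/
theorem natAbs_discr_le_condQn (K : Type) [Field K] [NumberField K] :
    ((NumberField.discr K).natAbs : ℝ) ≤ ThornerZaman.condQn K := by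
  rw [ThornerZaman.condQn, Nat.cast_natAbs, Int.cast_abs]
  have hn1 : (1 : ℝ) ≤ (Module.finrank ℚ K : ℝ) ^ Module.finrank ℚ K := by
    have : (1 : ℝ) ≤ Module.finrank ℚ K := by
      exact_mod_cast Module.finrank_pos (R := ℚ) (M := K)
    exact one_le_pow₀ this
  nlinarith [abs_nonneg ((NumberField.discr K : ℝ))]

/-- `0 ≤ log|d_K| ≤ Q − 1`.
[cite: ThornerZaman2019, §5 proof of Thm. 5.1 (smoothed character sums Σ Λ_χ(n) g(log n); one-sided form)] -/
theorem log_natAbs_discr_mem (K : Type) [Field K] [NumberField K] :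
    0 ≤ Real.log ((NumberField.discr K).natAbs : ℝ) ∧
      Real.log ((NumberField.discr K).natAbs : ℝ) ≤ ThornerZaman.condQn K - 1 := by
  have hd1 : (1 : ℝ) ≤ ((NumberField.discr K).natAbs : ℝ) := by
    have h1 : 1 ≤ (NumberField.discr K).natAbs :=
      Nat.one_le_iff_ne_zero.2 (Int.natAbs_ne_zero.2 (NumberField.discr_ne_zero K))
    exact_mod_cast h1
  have h1 := Real.log_le_sub_one_of_pos (by linarith : (0:ℝ) < ((NumberField.discr K).natAbs : ℝ))
  have h2 := natAbs_discr_le_condQn K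
  exact ⟨Real.log_nonneg hd1, by linarith⟩

/-- `t ≤ exp y` once `log t ≤ y` (`t > 0`).
[cite: ThornerZaman2019, §5 proof of Thm. 5.1 (smoothed character sums Σ Λ_χ(n) g(log n); one-sided form)] -/
theorem le_exp_of_log_le {y t : ℝ} (ht : 0 < t) (h : Real.log t ≤ y) : t ≤ Real.exp y :=
  calc t = Real.exp (Real.log t) := (Real.exp_log ht).symm
    _ ≤ Real.exp y := Real.exp_le_exp.2 h

/-- `L ≤ 8 e^{L/8}`.
[cite: ThornerZaman2019, §5 proof of Thm. 5.1 (smoothed character sums Σ Λ_χ(n) g(log n); one-sided form)] -/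
theorem le_eight_mul_exp_div (L : ℝ) : L ≤ 8 * Real.exp (L / 8) := by
  have := Real.add_one_le_exp (L / 8); linarith

/-! ### The zero-free region in `Q`-form -/

/-- (iii) The trivial zero: `m₀ (L + ε) ≤ 1152 e^{L/4}` for `χ ≠ 1`, `K` of degree `n > 1`,
`Q ≤ e^{L/8}`, `0 ≤ ε ≤ 1 ≤ L` (`m₀ ≤ 8(log|d_K| + 6n + 2) ≤ 72 Q`, `L ≤ 8e^{L/8}`).
[cite: ThornerZaman2019, §5 proof of Thm. 5.1 (smoothed character sums Σ Λ_χ(n) g(log n); one-sided form)] -/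
theorem trivialZero_term_le (K : Type) [Field K] [NumberField K] (hK : 1 < Module.finrank ℚ K)
    {χ : ClassGroup (𝓞 K) →* ℂˣ} (hχ : χ ≠ 1) {L ε : ℝ} (hL : 1 ≤ L) (hε0 : 0 ≤ ε) (hε1 : ε ≤ 1)
    (hQexp : ThornerZaman.condQn K ≤ Real.exp (L / 8)) :
    (analyticOrderNatAt (classGroupLFunction₀ K χ) 0 : ℝ) * (L + ε) ≤ 1152 * Real.exp (L / 4) := by
  set Q := ThornerZaman.condQn K with hQ
  have hQ12 : (12 : ℝ) ≤ Q := ThornerZaman.twelve_le_condQn (K := K) hK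
  have hm₀ := analyticOrderNatAt_classGroupLFunction₀_zero_le (K := K) hχ
  obtain ⟨-, hlogd⟩ := log_natAbs_discr_mem K
  have hnQ : (Module.finrank ℚ K : ℝ) ≤ Q := ThornerZaman.finrank_le_condQn (K := K)
  have h1 : 8 * (Real.log ((NumberField.discr K).natAbs : ℝ) + 6 * Module.finrank ℚ K + 2) ≤ 72 * Q := by
    rw [← hQ] at hlogd; linarith
  have h2 : L + ε ≤ 2 * L := by linarith
  have h3 : (analyticOrderNatAt (classGroupLFunction₀ K χ) 0 : ℝ) * (L + ε) ≤ 72 * Q * (2 * L) :=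
    mul_le_mul (hm₀.trans h1) h2 (by linarith) (by positivity)
  have hL8 := le_eight_mul_exp_div L
  have hee : Real.exp (L / 8) * Real.exp (L / 8) = Real.exp (L / 4) := by
    rw [← Real.exp_add]; ring_nf
  have h4 : Q * L ≤ Real.exp (L / 8) * (8 * Real.exp (L / 8)) :=
    mul_le_mul hQexp hL8 (by linarith) (Real.exp_pos _).le
  nlinarith [Real.exp_pos (L / 8)]

/-- (iv) The left-line integral: with the constant `Al` of
`exists_norm_logDeriv_classGroupLFunction_left_le` and the smooth-transition bound `M`,
`‖J_χ(0)‖ ≤ 8 · leftLineConst · Al (n + 1) M` for `g = tzTest L ε`, `ε = e^{−νL}`, `0 < ν ≤ 1/64`,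
`Q ≤ e^{L/8}`, `0 < ε < L/2`, `ε ≤ 1`.
[cite: ThornerZaman2019, §5 proof of Thm. 5.1 (smoothed character sums Σ Λ_χ(n) g(log n); one-sided form)] -/
theorem leftLine_term_le {Al : ℝ} (hAl0 : 0 < Al)
    (hAl : ∀ (K : Type) [Field K] [NumberField K] (χ : ClassGroup (𝓞 K) →* ℂˣ) (t : ℝ),
      ‖logDeriv (classGroupLFunction K χ) (-1 / 2 + t * I)‖ ≤
        Al * (Module.finrank ℚ K + 1) * (Real.log ((NumberField.discr K).natAbs : ℝ) + Real.log (|t| + 4)))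
    {M : ℝ} (hM : ∀ y : ℝ, |iteratedDeriv 1 Real.smoothTransition y| ≤ M ∧
      |iteratedDeriv 2 Real.smoothTransition y| ≤ M)
    (K : Type) [Field K] [NumberField K] (hK : 1 < Module.finrank ℚ K)
    {χ : ClassGroup (𝓞 K) →* ℂˣ} (hχ : χ ≠ 1) {L ε ν : ℝ} (hL : 0 < L) (hε : 0 < ε) (hεL : ε < L / 2)
    (hε1 : ε ≤ 1) (hν64 : ν ≤ 1 / 64) (hεexp : ε = Real.exp (-(ν * L)))
    (hQexp : ThornerZaman.condQn K ≤ Real.exp (L / 8)) :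
    ‖cgEFRemainder χ (tzTest L ε) 0‖ ≤ 8 * leftLineConst * Al * (Module.finrank ℚ K + 1) * M := by
  have hJ := norm_cgEFRemainder_tzTest_zero_le hAl0 hAl hχ hM hL hε hεL
  have hM0 : 0 ≤ M := le_trans (abs_nonneg _) (hM 0).1
  have hlC := leftLineConst_nonneg
  set Q := ThornerZaman.condQn K with hQ
  have hQ12 : (12 : ℝ) ≤ Q := ThornerZaman.twelve_le_condQn (K := K) hK
  obtain ⟨hlogd0, hlogd⟩ := log_natAbs_discr_mem K
  have hlogd4 : Real.log ((NumberField.discr K).natAbs : ℝ) + Real.log 4 + 1 ≤ 2 * Q := by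
    have hlog4 : Real.log 4 ≤ 2 := by
      have : Real.log 4 = 2 * Real.log 2 := by
        rw [show (4:ℝ) = 2 ^ 2 by norm_num, Real.log_pow]; norm_num
      rw [this]; have := Real.log_two_lt_d9; linarith
    rw [← hQ] at hlogd; linarith
  have hexp1 : Real.exp (-(L / 4) + ε / 2) ≤ 2 * Real.exp (-(L / 4)) := by
    rw [Real.exp_add, mul_comm]
    refine mul_le_mul_of_nonneg_right ?_ (Real.exp_pos _).le
    have hsq : Real.exp (ε / 2) ^ 2 < 2 ^ 2 := by
      rw [← Real.exp_nat_mul]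
      have h1 : Real.exp ((2 : ℕ) * (ε / 2)) ≤ Real.exp 1 := Real.exp_le_exp.2 (by push_cast; linarith)
      have := Real.exp_one_lt_d9; linarith
    exact (lt_of_pow_lt_pow_left₀ 2 (by norm_num) hsq).le
  have hexp2 : 2 * M / ε ≤ 2 * M * Real.exp (L / 64) := by
    rw [hεexp, div_eq_mul_inv, ← Real.exp_neg, neg_neg]
    refine mul_le_mul_of_nonneg_left (Real.exp_le_exp.2 ?_) (by positivity)
    nlinarith
  have hlog40 : 0 ≤ Real.log 4 := Real.log_nonneg (by norm_num)
  have hprod : (Real.log ((NumberField.discr K).natAbs : ℝ) + Real.log 4 + 1) *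
      (Real.exp (-(L / 4) + ε / 2) * (2 * M / ε)) ≤ 8 * M := by
    calc (Real.log ((NumberField.discr K).natAbs : ℝ) + Real.log 4 + 1) *
          (Real.exp (-(L / 4) + ε / 2) * (2 * M / ε))
        ≤ (2 * Q) * ((2 * Real.exp (-(L / 4))) * (2 * M * Real.exp (L / 64))) :=
          mul_le_mul hlogd4 (mul_le_mul hexp1 hexp2 (by positivity) (by positivity))
            (by positivity) (by positivity)
      _ ≤ (2 * Real.exp (L / 8)) * ((2 * Real.exp (-(L / 4))) * (2 * M * Real.exp (L / 64))) :=
          mul_le_mul_of_nonneg_right (by linarith) (by positivity)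
      _ = 8 * M * Real.exp (L / 8 + -(L / 4) + L / 64) := by
          rw [Real.exp_add, Real.exp_add]; ring
      _ ≤ 8 * M * 1 := by
          refine mul_le_mul_of_nonneg_left ?_ (by positivity)
          rw [Real.exp_le_one_iff]; nlinarith
      _ = 8 * M := mul_one _
  refine hJ.trans ?_
  rw [mul_assoc (leftLineConst * (Al * ((Module.finrank ℚ K : ℝ) + 1)))]
  calc leftLineConst * (Al * ((Module.finrank ℚ K : ℝ) + 1)) *
        ((Real.log ((NumberField.discr K).natAbs : ℝ) + Real.log 4 + 1) *
          (Real.exp (-(L / 4) + ε / 2) * (2 * M / ε)))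
      ≤ leftLineConst * (Al * ((Module.finrank ℚ K : ℝ) + 1)) * (8 * M) :=
        mul_le_mul_of_nonneg_left hprod (by positivity)
    _ = _ := by ring

/-! ### The smoothed character sum -/

end Literature.NumberTheory.LFunctions.NumberField.ClassPNT

end Part2

/-!
## Part 3 — port of `Summits/QuantumAdvantage/QuantumAdvantage/Theorems/LinnikCubicClassGroupsDegreeOnePrimesEscapeClassPNTFamilyZeroSumZFR.lean` (2 declarations kept)

# The class prime number theorem with the Deuring–Heilbronn phenomenon, I: the zero terms of the
# whole family off the exceptional segment, with the zero-free region as a PARAMETER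

Twin of `fam_finitePart_le_local` / `fam_zeroSum_le_local` (`…ClassPNTFamilyZeroSum.lean`) in which the
zero-free region off the exceptional segment is NOT derived from clause (1) of the Landau–Page package but
is a HYPOTHESIS with its own constant `c_Z`: every zero `ρ = β + iγ` of every `F_ψ` with `1/4 ≤ β < 1`,
`|γ| ≤ x`, off `excRegion c K`, has `β ≤ 1 − c_Z/(a log Q + log(|γ| + 4))`.  Conclusion:
`Σ_ψ Σ_{ρ ∈ u ψ, ¬exc} m_ψ(ρ) ‖F(−ρ)‖ ≤ A₀ x (e^{−c_Z L/(4a log Q)} + e^{−√(c_Z L/4)}) + A₀ x^{1−ν}`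
(`fam_zeroSum_le_local_zfr`), `ν, a₀, A₀` depending on `n, b, D, a` ONLY (not on `c_Z`, which may depend
on `K` and `x`).  This is how the Deuring–Heilbronn phenomenon (`c_Z ≍ log(1/((1 − β₁) log x))/n`) is
fed into the explicit formula.  Reference: J. Thorner, A. Zaman, Algebra Number Theory 13 (2019),
Lemmas 4.5–4.6, §4.3 [ThornerZaman2019]; E. Bombieri, Astérisque 18, Théorème 14, §6 [Bombieri1974].
-/

section Part3

open _root_.Complex _root_.Real _root_.MeasureTheory _root_.Set _root_.Filter _root_.Topology
open scoped _root_.NumberField nonZeroDivisors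

namespace Literature.NumberTheory.LFunctions.NumberField.ClassPNT

open Literature.NumberTheory.LFunctions Literature.NumberTheory.LFunctions.NumberField
  Literature.NumberTheory.LFunctions.EntireEF Literature.NumberTheory.LFunctions.TZWeight
  Literature.NumberTheory.LFunctions.AbelianDensity

variable {K : Type} [Field K] [NumberField K]

/-! ### The finite part -/

set_option maxHeartbeats 800000 in
/-- **The finite part of the zero sum of the family, general degree, zero-free region as a parameter**
(Thorner–Zaman Lemmas 4.5–4.6 for `Ĉl_K`): with the density bound in `Q`-form (`𝓠 = a log Q`, `a ≥ 1`),
`c_Z > 0` such that every zero of the family in `famFin ψ T₁` off `excRegion c K` with `β ≥ 1/4` has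
`β ≤ 1 − c_Z/(a log Q + log(|γ|+4))`, `x > 1` and `T₁ ≥ 1` with `e^{b(a log Q + log(2T₁+4))} ≤ x^{1/2}`:
`Σ_ψ Σ_{ρ ∈ famFin ψ T₁, ¬exc, β ≥ 1/4} m x^{β−1}/max(1,|γ|) ≤ 64 D (e^{−c_Z L/(4a log Q)} + e^{−√(c_Z L/4)})`.
[cite: ThornerZaman2019, §4.3 Lemmas 4.5–4.6 (zero terms of the family off the exceptional segment, zero-free region as parameter)] -/
theorem fam_finitePart_le_local_zfr {b D a : ℝ} (hb : 0 < b) (hD : 0 < D) (ha : 1 ≤ a)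
    (hK : 1 < Module.finrank ℚ K)
    (hdens : ∀ (T : ℝ), 1 ≤ T → ∀ u : AddChar (Additive (ClassGroup (𝓞 K))) ℂ → Finset ℂ,
        (∀ ψ, ∀ ρ ∈ u ψ, famF K ψ ρ = 0 ∧ 1 / 4 ≤ ρ.re ∧ ρ.re < 1 ∧ |ρ.im| ≤ T) →
        ∀ α : ℝ, α ≤ 1 →
          ∑ ψ, ∑ ρ ∈ u ψ with α ≤ ρ.re, (famMult K ψ ρ : ℝ) ≤
            D * Real.exp (b * (a * Real.log (ThornerZaman.condQn K) + Real.log (T + 4))) ^ (1 - α))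
    (c : ℝ) {c_Z : ℝ} (hcZ : 0 < c_Z) {x T₁ : ℝ} (hx : 1 < x) (hT₁ : 1 ≤ T₁)
    (hzfr : ∀ ψ, ∀ ρ ∈ famFin K ψ T₁, ¬ excRegion c K ρ → 1 / 4 ≤ ρ.re →
      ρ.re ≤ 1 - c_Z / (a * Real.log (ThornerZaman.condQn K) + Real.log (|ρ.im| + 4)))
    (hrange : Real.exp (b * (a * Real.log (ThornerZaman.condQn K) + Real.log (2 * T₁ + 4))) ≤
      x ^ ((1 : ℝ) / 2)) :
    ∑ ψ, ∑ ρ ∈ famFin K ψ T₁ with (¬ excRegion c K ρ ∧ 1 / 4 ≤ ρ.re),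
        (famMult K ψ ρ : ℝ) * x ^ (ρ.re - 1) / max 1 |ρ.im| ≤
      64 * D * (Real.exp (-(c_Z * Real.log x / (4 * a * Real.log (ThornerZaman.condQn K)))) +
        Real.exp (-Real.sqrt (c_Z * Real.log x / 4))) := by
  classical
  set Q : ℝ := ThornerZaman.condQn K with hQ
  have hQ12 : (12 : ℝ) ≤ Q := ThornerZaman.twelve_le_condQn (K := K) hK
  have hlogQ : Real.log 12 ≤ Real.log Q := Real.log_le_log (by norm_num) hQ12
  have hlog12 : (2 : ℝ) ≤ Real.log 12 := by
    rw [Real.le_log_iff_exp_le (by norm_num)]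
    have := Real.exp_one_lt_d9
    have h : Real.exp 2 = Real.exp 1 * Real.exp 1 := by rw [← Real.exp_add]; norm_num
    rw [h]; nlinarith [Real.exp_pos (1:ℝ)]
  set 𝓠 : ℝ := a * Real.log Q with h𝓠
  have h𝓠1 : 1 ≤ 𝓠 := by rw [h𝓠]; nlinarith
  set Fin' : AddChar (Additive (ClassGroup (𝓞 K))) ℂ → Finset ℂ := fun ψ ↦
    (famFin K ψ T₁).filter (fun ρ ↦ ¬ excRegion c K ρ ∧ 1 / 4 ≤ ρ.re) with hFin'
  set s : Finset (Σ _ : AddChar (Additive (ClassGroup (𝓞 K))) ℂ, ℂ) := Finset.univ.sigma Fin' with hs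
  have hmem : ∀ i ∈ s, i.2 ∈ famFin K i.1 T₁ ∧ (famF K i.1 i.2 = 0 ∧ 0 < i.2.re ∧ i.2.re < 1) ∧
      |i.2.im| ≤ T₁ ∧ ¬ excRegion c K i.2 ∧ 1 / 4 ≤ i.2.re := by
    rintro ⟨ψ, ρ⟩ hi
    rw [hs, Finset.mem_sigma] at hi
    obtain ⟨-, hρ⟩ := hi
    rw [hFin'] at hρ; dsimp only at hρ
    rw [Finset.mem_filter] at hρ
    have hρ' := hρ.1
    rw [mem_famFin] at hρ'
    exact ⟨hρ.1, hρ'.1, hρ'.2, hρ.2.1, hρ.2.2⟩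
  have hconv : ∑ ψ, ∑ ρ ∈ famFin K ψ T₁ with (¬ excRegion c K ρ ∧ 1 / 4 ≤ ρ.re),
      (famMult K ψ ρ : ℝ) * x ^ (ρ.re - 1) / max 1 |ρ.im| =
      ∑ i ∈ s, (famMult K i.1 i.2 : ℝ) * x ^ (i.2.re - 1) / max 1 |i.2.im| := by
    rw [hs, Finset.sum_sigma]
  rw [hconv]
  have key := LinnikZeroSum.sum_rpow_div_le_of_density_zfr s (fun i ↦ i.2.re) (fun i ↦ i.2.im)
    (fun i ↦ (famMult K i.1 i.2 : ℝ)) (𝓠 := 𝓠) (c_Z := c_Z) (b := b) (D₀ := D) (T₁ := T₁)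
    hx h𝓠1 hcZ hb.le hD.le hT₁ (fun i _ ↦ Nat.cast_nonneg _) (fun i hi ↦ (hmem i hi).2.2.1) ?_ ?_ ?_
  · refine key.trans (le_of_eq ?_)
    rw [h𝓠]; congr 3; ring
  · -- the zero-free region off the exceptional segment (hypothesis)
    intro i hi
    obtain ⟨hfin, -, -, hexc, h14⟩ := hmem i hi
    have h1 := hzfr i.1 i.2 hfin hexc h14
    rw [h𝓠]; exact h1
  · -- density
    intro T α hT hα
    have hd' := hdens T hT (fun ψ ↦ (Fin' ψ).filter (fun ρ ↦ |ρ.im| ≤ T)) (fun ψ ρ hρ ↦ ?_) α hα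
    · refine le_of_eq_of_le ?_ hd'
      rw [hs]
      rw [show (∑ i ∈ (Finset.univ.sigma Fin') with (|i.2.im| ≤ T ∧ α ≤ i.2.re), (famMult K i.1 i.2 : ℝ)) =
          ∑ i ∈ Finset.univ.sigma (fun ψ ↦ ((Fin' ψ).filter (fun ρ ↦ |ρ.im| ≤ T)).filter (fun ρ ↦ α ≤ ρ.re)),
            (famMult K i.1 i.2 : ℝ) by
        refine Finset.sum_congr ?_ fun _ _ ↦ rfl
        ext ⟨ψ, ρ⟩
        simp only [Finset.mem_filter, Finset.mem_sigma, Finset.mem_univ, true_and]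
        tauto]
      rw [Finset.sum_sigma]
    · rw [Finset.mem_filter] at hρ
      rw [hFin'] at hρ; dsimp only at hρ
      rw [Finset.mem_filter, mem_famFin] at hρ
      exact ⟨hρ.1.1.1.1, hρ.1.2.2, hρ.1.1.1.2.2, hρ.2⟩
  · rwa [h𝓠]

/-! ### The whole zero sum -/

set_option maxHeartbeats 4000000 in
/-- **Thorner–Zaman §4.3 for `Ĉl_K`, uniformly over the number fields `K` of degree `n > 1`, with the
zero-free region as a parameter**: given the density bound in `Q`-form with constants `b, D, a`, there are
`ν ∈ (0, 1/64]`, `a₀ ≥ 1`, `A₀ > 0` (depending on `n, b, D, a` ONLY) such that for every `c`, every such `K`,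
every `x ≥ Q^{a₀}`, every `c_Z > 0` such that every zero `ρ` of every `F_ψ` with `1/4 ≤ Re ρ < 1`,
`|Im ρ| ≤ x`, off `excRegion c K`, has `Re ρ ≤ 1 − c_Z/(a log Q + log(|Im ρ| + 4))`, every `x^{−ν} ≤ ε ≤ 1`
and all finite sets `u ψ` of non-trivial zeros of `F_ψ`, the zero terms against the weight
`tzTest (log x) ε` off the exceptional segment satisfy
`Σ_ψ Σ_{ρ ∈ u ψ, ¬exc} m_ψ(ρ) ‖F(−ρ)‖ ≤ A₀ x (e^{−c_Z L/(4a log Q)} + e^{−√(c_Z L/4)}) + A₀ x^{1−ν}`.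
[cite: ThornerZaman2019, §4.3] -/
theorem fam_zeroSum_le_local_zfr (n : ℕ) (hn : 1 < n) {b D a : ℝ} (hb : 0 < b) (hD : 0 < D) (ha : 1 ≤ a) :
    ∃ ν a₀ A₀ : ℝ, 0 < ν ∧ ν ≤ 1 / 64 ∧ 1 ≤ a₀ ∧ 0 < A₀ ∧
    ∀ (c : ℝ) (K : Type) [Field K] [NumberField K], Module.finrank ℚ K = n →
      (∀ (T : ℝ), 1 ≤ T → ∀ u : AddChar (Additive (ClassGroup (𝓞 K))) ℂ → Finset ℂ,
        (∀ ψ, ∀ ρ ∈ u ψ, famF K ψ ρ = 0 ∧ 1 / 4 ≤ ρ.re ∧ ρ.re < 1 ∧ |ρ.im| ≤ T) →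
        ∀ α : ℝ, α ≤ 1 →
          ∑ ψ, ∑ ρ ∈ u ψ with α ≤ ρ.re, (famMult K ψ ρ : ℝ) ≤
            D * Real.exp (b * (a * Real.log (ThornerZaman.condQn K) + Real.log (T + 4))) ^ (1 - α)) →
      ∀ x : ℝ, ThornerZaman.condQn K ^ a₀ ≤ x → ∀ c_Z : ℝ, 0 < c_Z →
      (∀ (ψ : AddChar (Additive (ClassGroup (𝓞 K))) ℂ) (ρ : ℂ), famF K ψ ρ = 0 → 1 / 4 ≤ ρ.re →
        ρ.re < 1 → |ρ.im| ≤ x → ¬ excRegion c K ρ →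
          ρ.re ≤ 1 - c_Z / (a * Real.log (ThornerZaman.condQn K) + Real.log (|ρ.im| + 4))) →
      ∀ ε : ℝ, x ^ (-ν) ≤ ε → ε ≤ 1 →
      ∀ u : AddChar (Additive (ClassGroup (𝓞 K))) ℂ → Finset ℂ,
        (∀ ψ, ∀ ρ ∈ u ψ, famF K ψ ρ = 0 ∧ 0 < ρ.re ∧ ρ.re < 1) →
        ∑ ψ, ∑ ρ ∈ u ψ with ¬ excRegion c K ρ,
            (famMult K ψ ρ : ℝ) * ‖fordLaplace (tzTest (Real.log x) ε) (-ρ)‖ ≤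
          A₀ * x * (Real.exp (-(c_Z * Real.log x / (4 * a * Real.log (ThornerZaman.condQn K)))) +
              Real.exp (-Real.sqrt (c_Z * Real.log x / 4))) + A₀ * x ^ (1 - ν) := by
  classical
  obtain ⟨M, hM1, hM⟩ := TZWeight.exists_smoothTransition_deriv_bound
  obtain ⟨hc₁16, hc₂0⟩ := tailConst_nonneg
  set β₀ : ℝ := max b 1 with hβ₀
  have hβ₀1 : 1 ≤ β₀ := le_max_right _ _
  have hbβ₀ : b ≤ β₀ := le_max_left _ _
  set ν : ℝ := 1 / (64 * β₀) with hν
  have hν0 : 0 < ν := by positivity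
  have hν64 : ν ≤ 1 / 64 := by
    rw [hν]; exact one_div_le_one_div_of_le (by norm_num) (by nlinarith)
  set a₀ : ℝ := 400 * a * β₀ with ha₀
  set W₀ : ℝ := 512 * ((n : ℝ) + 1) with hW₀
  have hW₀0 : 0 ≤ W₀ := by positivity
  set A₁ : ℝ := 50 * W₀ * (1 / ν + 1 + 8 * M) + 2 * M * W₀ * (4 * tailConst₁ + tailConst₂) with hA₁
  have hA₁0 : 0 ≤ A₁ := by
    have : 0 ≤ M := by linarith
    have : 0 ≤ tailConst₁ := by linarith
    positivity
  set A₀ : ℝ := Real.exp 1 * (512 * M * D + A₁) with hA₀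
  refine ⟨ν, a₀, A₀, hν0, hν64, by rw [ha₀]; nlinarith, by positivity,
    fun c K _ _ hKn hdens x hx c_Z hcZ hzfr ε hεν hε1 u hu ↦ ?_⟩
  -- sizes
  have hK : 1 < Module.finrank ℚ K := by rw [hKn]; exact hn
  set Q : ℝ := ThornerZaman.condQn K with hQ
  have hQ12 : (12 : ℝ) ≤ Q := ThornerZaman.twelve_le_condQn (K := K) hK
  have hQ1 : (1 : ℝ) < Q := by linarith
  have hlog12 : (2 : ℝ) ≤ Real.log 12 := by
    rw [Real.le_log_iff_exp_le (by norm_num)]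
    have := Real.exp_one_lt_d9
    have h : Real.exp 2 = Real.exp 1 * Real.exp 1 := by rw [← Real.exp_add]; norm_num
    rw [h]; nlinarith [Real.exp_pos (1:ℝ)]
  have hlogQ : 2 ≤ Real.log Q := hlog12.trans (Real.log_le_log (by norm_num) hQ12)
  have ha₀1 : (1 : ℝ) ≤ a₀ := by rw [ha₀]; nlinarith
  have hxQ : Q ≤ x := by
    have : Q ^ (1 : ℝ) ≤ Q ^ a₀ := Real.rpow_le_rpow_of_exponent_le hQ1.le ha₀1
    rw [Real.rpow_one] at this; linarith
  have hx1 : 1 < x := by linarith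
  have hx0 : 0 < x := by linarith
  set Lx : ℝ := Real.log x with hLx
  have hLQ : a₀ * Real.log Q ≤ Lx := by
    have := Real.log_le_log (by positivity) hx
    rwa [Real.log_rpow (by linarith)] at this
  have hL800 : 800 * β₀ ≤ Lx := by nlinarith
  have hL0 : 0 < Lx := by linarith
  have hε0 : 0 < ε := lt_of_lt_of_le (Real.rpow_pos_of_pos hx0 _) hεν
  have hεL : ε < Lx / 2 := by linarith
  set T₁ : ℝ := x ^ (6 * ν) with hT₁
  have hT₁1 : 1 ≤ T₁ := Real.one_le_rpow hx1.le (by positivity)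
  have hT₁x : T₁ ≤ x := by
    have := Real.rpow_le_rpow_of_exponent_le hx1.le (by linarith : 6 * ν ≤ 1)
    rwa [Real.rpow_one] at this
  -- the zero-free region on `famFin ψ T₁`
  have hzfr' : ∀ ψ, ∀ ρ ∈ famFin K ψ T₁, ¬ excRegion c K ρ → 1 / 4 ≤ ρ.re →
      ρ.re ≤ 1 - c_Z / (a * Real.log (ThornerZaman.condQn K) + Real.log (|ρ.im| + 4)) := by
    intro ψ ρ hρ hexc h14
    rw [mem_famFin] at hρ
    exact hzfr ψ ρ hρ.1.1 h14 hρ.1.2.2 (hρ.2.trans hT₁x) hexc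
  -- the window data of the family (`n` general)
  set A : ℝ := Real.log ((NumberField.discr K).natAbs : ℝ) + 3 * n with hAdef
  have hAnn : 0 ≤ A := by have := Real.log_natCast_nonneg (NumberField.discr K).natAbs; positivity
  have hwin : ∀ ψ (τ : ℝ) (P : Finset ℂ), (∀ ρ ∈ P, famF K ψ ρ = 0 ∧ 0 < ρ.re ∧ ρ.re < 1 ∧ |ρ.im - τ| ≤ 1 / 2) →
      ∑ ρ ∈ P, (analyticOrderNatAt (famF K ψ) ρ : ℝ) ≤ W₀ * (A + Real.log (|τ| + 4)) := by
    intro ψ τ P hP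
    have := fam_window ψ τ P hP
    rw [hKn] at this
    convert this using 2
  -- (A) per character
  set g : AddChar (Additive (ClassGroup (𝓞 K))) ℂ → ℂ → ℝ := fun ψ ρ ↦
    (famMult K ψ ρ : ℝ) * ‖fordLaplace (TZWeight.tzTest Lx ε) (-ρ)‖ with hg
  set 𝓠 : ℝ := a * Real.log Q with h𝓠
  set S : AddChar (Additive (ClassGroup (𝓞 K))) ℂ → ℝ := fun ψ ↦
    ∑ ρ ∈ famFin K ψ T₁ with (¬ excRegion c K ρ ∧ 1 / 4 ≤ ρ.re),
      (famMult K ψ ρ : ℝ) * x ^ (ρ.re - 1) / max 1 |ρ.im| with hS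
  set J : ℝ := (Lx + ε + 8 * M) * x ^ (-(3 : ℝ) / 4) * ((2 * T₁ + 3) * (W₀ * (A + Real.log (T₁ + 5)))) +
    (2 * M / ε) * T₁ ^ (-((1 : ℝ) / 2)) * (W₀ * (tailConst₁ * A + tailConst₂)) with hJ
  have hexpL : Real.exp Lx = x := by rw [hLx, Real.exp_log hx0]
  have hM0 : 0 ≤ M := by linarith
  have hper : ∀ ψ, ∑ ρ ∈ u ψ with ¬ excRegion c K ρ, g ψ ρ ≤ Real.exp ε * x * (8 * M * S ψ + J) := by
    intro ψ
    have hdp : DecidablePred (· ∈ nontrivialZeros (famF K ψ)) := fun _ ↦ Classical.propDecidable _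
    set Exc : Finset ℂ := (famFin K ψ T₁ ∪ u ψ).filter (excRegion c K) with hExc
    set u' : Finset (nontrivialZeros (famF K ψ)) :=
      ((u ψ).filter (fun ρ ↦ ¬ excRegion c K ρ)).subtype (· ∈ nontrivialZeros (famF K ψ)) with hu'
    have key := sum_zeroTerm_le (differentiable_famF ψ) (famF_two_ne_zero ψ) (W := W₀) (A := A)
      hW₀0 hAnn (hwin ψ) hM hL0 hε0 hεL hT₁1 Exc u'
    -- the left side
    have h1 : u'.filter (fun ρ' : nontrivialZeros (famF K ψ) ↦ (ρ' : ℂ) ∉ Exc) = u' := by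
      refine Finset.filter_true_of_mem fun ρ' hρ' ↦ ?_
      rw [hu', Finset.mem_subtype, Finset.mem_filter] at hρ'
      rw [hExc, Finset.mem_filter, not_and_or]
      exact Or.inr hρ'.2
    rw [h1] at key
    have hLHS : ∑ ρ' ∈ u', (analyticOrderNatAt (famF K ψ) (ρ' : ℂ) : ℝ) *
        ‖fordLaplace (TZWeight.tzTest Lx ε) (-(ρ' : ℂ))‖ =
        ∑ ρ ∈ u ψ with ¬ excRegion c K ρ, g ψ ρ := by
      rw [hu', Finset.sum_subtype_of_mem (fun ρ : ℂ ↦ (analyticOrderNatAt (famF K ψ) ρ : ℝ) *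
        ‖fordLaplace (TZWeight.tzTest Lx ε) (-ρ)‖)]
      · exact Finset.sum_congr rfl fun _ _ ↦ rfl
      intro ρ hρ
      rw [Finset.mem_filter] at hρ
      exact hu ψ ρ hρ.1
    rw [hLHS] at key
    refine key.trans ?_
    rw [hexpL]
    refine mul_le_mul_of_nonneg_left ?_ (by positivity)
    rw [add_assoc]
    refine add_le_add ?_ ?_
    · -- the finite part: the filter `ρ ∉ Exc` is `¬ excRegion` on `famFin`
      refine mul_le_mul_of_nonneg_left (le_of_eq ?_) (by positivity)
      rw [hS]; dsimp only
      change ∑ ρ ∈ (famFin K ψ T₁).filter (fun ρ ↦ ρ ∉ Exc ∧ 1 / 4 ≤ ρ.re), _ = _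
      refine Finset.sum_congr (Finset.filter_congr fun ρ hρ ↦ ?_) fun _ _ ↦ rfl
      rw [hExc, Finset.mem_filter, not_and_or]
      constructor
      · rintro ⟨h | h, h14⟩
        · exact absurd (Finset.mem_union_left _ hρ) h
        · exact ⟨h, h14⟩
      · rintro ⟨h, h14⟩; exact ⟨Or.inr h, h14⟩
    · -- the junk of `ψ`
      rw [hJ]
      refine add_le_add (mul_le_mul_of_nonneg_left ?_ ?_) le_rfl
      · change ∑ ρ ∈ famFin K ψ T₁, (analyticOrderNatAt (famF K ψ) ρ : ℝ) ≤ _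
        refine sum_mult_le_of_window hW₀0 hAnn (hwin ψ) (by linarith) _ fun ρ hρ ↦ ?_
        rw [mem_famFin] at hρ
        exact ⟨hρ.1.1, hρ.1.2.1, hρ.1.2.2, hρ.2⟩
      · positivity
  -- (B) sum over `ψ`
  have hsum : ∑ ψ, ∑ ρ ∈ u ψ with ¬ excRegion c K ρ, g ψ ρ ≤
      Real.exp ε * x * (8 * M * ∑ ψ, S ψ + (NumberField.classNumber K : ℝ) * J) := by
    refine (Finset.sum_le_sum fun ψ _ ↦ hper ψ).trans (le_of_eq ?_)
    rw [← Finset.mul_sum, Finset.sum_add_distrib, Finset.mul_sum, Finset.sum_const, nsmul_eq_mul,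
      Finset.card_univ, card_addChar_classGroup]
  -- (C) the finite part by density + ZFR
  have hrange : Real.exp (b * (a * Real.log Q + Real.log (2 * T₁ + 4))) ≤ x ^ ((1 : ℝ) / 2) := by
    rw [show x ^ ((1 : ℝ) / 2) = Real.exp (Lx / 2) by rw [hLx, Real.rpow_def_of_pos hx0]; ring_nf]
    refine Real.exp_le_exp.2 ?_
    have hT6 : Real.log (2 * T₁ + 4) ≤ 2 + 6 * ν * Lx := by
      have h1 : Real.log (2 * T₁ + 4) ≤ Real.log (6 * T₁) :=
        Real.log_le_log (by linarith only [hT₁1]) (by linarith only [hT₁1])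
      rw [Real.log_mul (by norm_num) (by linarith only [hT₁1]), hT₁, Real.log_rpow hx0, ← hLx] at h1
      have h3 : Real.log 6 ≤ 2 := by
        rw [Real.log_le_iff_le_exp (by norm_num)]
        have := Real.exp_one_gt_d9
        have h : Real.exp 2 = Real.exp 1 * Real.exp 1 := by rw [← Real.exp_add]; norm_num
        rw [h]; nlinarith only [this]
      linarith only [h1, h3]
    have hbν : b * (6 * ν * Lx) ≤ 6 / 64 * Lx := by
      have hbν' : b * ν ≤ 1 / 64 := by
        rw [hν]; rw [show b * (1 / (64 * β₀)) = b / β₀ / 64 by ring]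
        have : b / β₀ ≤ 1 := (div_le_one (by positivity)).2 hbβ₀
        linarith
      have : b * (6 * ν * Lx) = 6 * (b * ν) * Lx := by ring
      rw [this]
      have := mul_le_mul_of_nonneg_right hbν' hL0.le
      linarith only [this]
    have hb2 : b * 2 ≤ Lx / 400 := by
      have : 1 ≤ a := ha
      nlinarith only [hbβ₀, hL800, this, hβ₀1]
    have hbQ : b * (a * Real.log Q) ≤ Lx / 400 := by
      have h0Q : 0 ≤ a * Real.log Q := by nlinarith only [hlogQ, ha]
      have h1 : b * (a * Real.log Q) ≤ β₀ * (a * Real.log Q) := mul_le_mul_of_nonneg_right hbβ₀ h0Q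
      have h2' : β₀ * (a * Real.log Q) = (a₀ * Real.log Q) / 400 := by rw [ha₀]; ring
      rw [h2'] at h1
      have h3 : (a₀ * Real.log Q) / 400 ≤ Lx / 400 := by linarith only [hLQ]
      linarith only [h1, h3]
    have h4 : b * Real.log (2 * T₁ + 4) ≤ b * 2 + b * (6 * ν * Lx) := by
      have := mul_le_mul_of_nonneg_left hT6 hb.le; linarith only [this]
    have h5 : b * (a * Real.log Q + Real.log (2 * T₁ + 4)) =
        b * (a * Real.log Q) + b * Real.log (2 * T₁ + 4) := by ring
    rw [h5]
    linarith only [hbQ, h4, hbν, hb2, hL0]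
  have hfin := fam_finitePart_le_local_zfr hb hD ha hK hdens c hcZ hx1 hT₁1 hzfr' hrange
  -- (D) the junk, with `Q²` in place of `Q` (`h_K ≤ Q⁴ = (Q²)²`, `(Q²)³ = Q⁶ ≤ x^ν`)
  have hQsq12 : (12 : ℝ) ≤ Q ^ 2 := by nlinarith
  have hh : (NumberField.classNumber K : ℝ) ≤ (Q ^ 2) ^ 2 := by
    have h1 := ThornerZaman.classNumber_le_condQn_pow (K := K) hK
    rw [← hQ] at h1
    calc (NumberField.classNumber K : ℝ) ≤ Q ^ 4 := h1
      _ = (Q ^ 2) ^ 2 := by ring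
  have hAQ : A ≤ 4 * Q ^ 2 := by
    have := windowConst_le_condQn K
    rw [hKn, ← hQ] at this
    rw [hAdef]
    nlinarith
  have hQ6 : (Q ^ 2) ^ 3 ≤ x ^ ν := by
    have h1 : (Q ^ 2) ^ 3 = Real.exp (6 * Real.log Q) := by
      rw [show (Q ^ 2) ^ 3 = Q ^ 6 by ring, ← Real.rpow_natCast, Real.rpow_def_of_pos (by linarith)]
      norm_num; ring_nf
    rw [h1, Real.rpow_def_of_pos hx0, ← hLx]
    refine Real.exp_le_exp.2 ?_
    have haν : a₀ * ν = 400 * a / 64 := by rw [ha₀, hν]; field_simp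
    have h2' : ν * (a₀ * Real.log Q) ≤ ν * Lx := mul_le_mul_of_nonneg_left hLQ hν0.le
    have h3 : ν * (a₀ * Real.log Q) = 400 * a / 64 * Real.log Q := by rw [← haν]; ring
    have h0Q : 0 ≤ Real.log Q := by linarith only [hlogQ]
    nlinarith only [h2', h3, h0Q, ha]
  have hjunk : (NumberField.classNumber K : ℝ) * J ≤ A₁ * x ^ (-ν) := by
    rw [hJ, hA₁, hT₁, hLx]
    exact junk_le hν0 hν64 hQsq12 hQ6 hx1 (Nat.cast_nonneg _) hh hAnn hAQ hM1 hW₀0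
      (by linarith) hc₂0 hεν hε1
  -- (E) assemble
  have hεe : Real.exp ε ≤ Real.exp 1 := Real.exp_le_exp.2 hε1
  set E : ℝ := Real.exp (-(c_Z * Lx / (4 * 𝓠))) + Real.exp (-Real.sqrt (c_Z * Lx / 4)) with hE
  have hE0 : 0 ≤ E := by positivity
  have hxν : x * x ^ (-ν) = x ^ (1 - ν) := by
    rw [sub_eq_add_neg, Real.rpow_add hx0, Real.rpow_one]
  have hE' : Real.exp (-(c_Z * Real.log x / (4 * a * Real.log (ThornerZaman.condQn K)))) +
      Real.exp (-Real.sqrt (c_Z * Real.log x / 4)) = E := by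
    rw [hE, h𝓠, hQ, hLx]; ring_nf
  have hfin' : ∑ ψ, S ψ ≤ 64 * D * E := by
    rw [hE, h𝓠, hLx]
    refine le_of_eq_of_le ?_ (hfin.trans (le_of_eq ?_))
    · rfl
    · rw [hQ]; ring_nf
  rw [hE']
  have hgoal : ∑ ψ, ∑ ρ ∈ u ψ with ¬ excRegion c K ρ,
      (famMult K ψ ρ : ℝ) * ‖fordLaplace (tzTest (Real.log x) ε) (-ρ)‖ =
      ∑ ψ, ∑ ρ ∈ u ψ with ¬ excRegion c K ρ, g ψ ρ := by rw [hg, hLx]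
  rw [hgoal]
  calc ∑ ψ, ∑ ρ ∈ u ψ with ¬ excRegion c K ρ, g ψ ρ
      ≤ Real.exp ε * x * (8 * M * ∑ ψ, S ψ + (NumberField.classNumber K : ℝ) * J) := hsum
    _ ≤ Real.exp 1 * x * (8 * M * (64 * D * E) + A₁ * x ^ (-ν)) := by
        have hin : 0 ≤ 8 * M * ∑ ψ, S ψ + (NumberField.classNumber K : ℝ) * J := by
          have hS0 : 0 ≤ ∑ ψ, S ψ := Finset.sum_nonneg fun ψ _ ↦ by
            rw [hS]; exact Finset.sum_nonneg fun ρ _ ↦ div_nonneg (mul_nonneg (Nat.cast_nonneg _)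
              (Real.rpow_nonneg hx0.le _)) (by positivity)
          have hJ0 : 0 ≤ J := by
            rw [hJ]
            have : 0 ≤ Real.log (T₁ + 5) := Real.log_nonneg (by linarith)
            have ht1 : 0 ≤ tailConst₁ := by linarith
            have : 0 ≤ tailConst₁ * A + tailConst₂ := by positivity
            positivity
          positivity
        exact mul_le_mul (mul_le_mul_of_nonneg_right hεe hx0.le)
          (add_le_add (mul_le_mul_of_nonneg_left hfin' (by positivity)) hjunk) hin (by positivity)
    _ = Real.exp 1 * (512 * M * D) * x * E + Real.exp 1 * A₁ * x ^ (1 - ν) := by rw [← hxν]; ring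
    _ ≤ A₀ * x * E + A₀ * x ^ (1 - ν) := by
        refine add_le_add ?_ ?_
        · rw [hA₀]
          have h0 : 0 ≤ Real.exp 1 * A₁ * (x * E) := by positivity
          nlinarith only [h0]
        · refine mul_le_mul_of_nonneg_right ?_ (Real.rpow_nonneg hx0.le _)
          rw [hA₀]
          have : 0 ≤ Real.exp 1 * (512 * M * D) := by positivity
          nlinarith only [this]

end Literature.NumberTheory.LFunctions.NumberField.ClassPNT

end Part3

/-!
## Part 4 — port of `Summits/QuantumAdvantage/QuantumAdvantage/Theorems/LinnikCubicClassGroupsDegreeOnePrimesEscapeClassPNTSmoothed.lean` (4 declarations kept)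

# The additive class prime number theorem, III: the smoothed class sums through the explicit
# formulae of the whole family, two-sided, with the exceptional zeros kept

For a number field `K`, a class `C`, the weight `g = tzTest (log x) ε`, its Laplace transform `F` and the
family `F_ψ` (`ψ ∈ Ĉl_K`; `F_0 = ζ₁_K`, `F_ψ = L₀(·,χ_ψ)`), orthogonality
(`classNumber_mul_smoothedPsiClass`) and the explicit formulae (`coefFordK_one_eq_explicit`,
`coefFordK_eq_explicit`) give, TWO-SIDEDLY and with a prescribed finite set `Exc ψ` of non-trivial zeros
of `F_ψ` kept on the main-term side,

  `‖h ψ̃_C(g) − F(−1) + Σ_ψ ψ(C⁻¹) Σ_{ρ ∈ Exc ψ} m_ψ(ρ) F(−ρ)‖ ≤ B + h (M₀ + J)`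

(`norm_classNumber_mul_smoothedPsiClass_sub_le`), where `B` bounds the zero terms `Σ_ψ Σ m‖F(−ρ)‖` over
the zeros NOT in `Exc ψ` (all finite partial sums, as supplied by `fam_zeroSum_le_local`), `M₀` the
trivial-zero terms `m_ψ(0)(L + ε)` and `J` the left-line integrals.  Ingredients: the abstract two-sided
reading of one explicit formula (`norm_explicit_core`), its instance for `F_ψ` (`norm_coefFordK_famF_sub_le`),
and a supremum lemma (`sum_ciSup_le_of_forall_sum_le`) passing the FAMILY bound for finite partial sums to
the sum over `ψ` of the per-character suprema.
-/

section Part4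

open _root_.Complex _root_.Real _root_.MeasureTheory _root_.Set _root_.Filter _root_.Topology
open scoped _root_.NumberField nonZeroDivisors

namespace Literature.NumberTheory.LFunctions.NumberField.ClassPNT

open Literature.NumberTheory.LFunctions Literature.NumberTheory.LFunctions.NumberField
  Literature.NumberTheory.LFunctions.EntireEF Literature.NumberTheory.LFunctions.TZWeight
  Literature.NumberTheory.LFunctions.AbelianDensity

/-! ### The abstract two-sided reading of one explicit formula -/

/-- **Two-sided reading of an explicit formula with prescribed exceptional zeros.**  If
`Kv = main − Σ'_ρ m(ρ) F₀(0 − ρ) − m₀ F₀(0) + J` (sum over the non-trivial zeros of `f`, absolutely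
convergent), `Exc` is a finite set of non-trivial zeros, every finite partial sum of `m ‖F(−ρ)‖` over the
non-trivial zeros outside `Exc` is `≤ B`, and `‖F₀(0)‖ ≤ F0`, then
`‖Kv − main + Σ_{ρ ∈ Exc} m(ρ) F(−ρ)‖ ≤ B + m₀ F0 + ‖J‖` (`F₀ = F` as `g(0) = 0`).
[cite: ThornerZaman2019, §5 proof of Thm. 5.1 (explicit formulae of the family, smoothed class sums, exceptional zeros kept)] -/
theorem norm_explicit_core {f : ℂ → ℂ} {g : ℝ → ℝ} (hg0 : g 0 = 0) {Kv main J : ℂ} {F0 : ℝ}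
    (hsum : Summable fun ρ : nontrivialZeros f ↦
      ‖(analyticOrderNatAt f (ρ : ℂ) : ℂ) * fordLaplace₀ g (0 - (ρ : ℂ))‖)
    (hK : Kv = main - (∑' ρ : nontrivialZeros f,
        (analyticOrderNatAt f (ρ : ℂ) : ℂ) * fordLaplace₀ g (0 - (ρ : ℂ))) -
        (analyticOrderNatAt f 0 : ℂ) * fordLaplace₀ g 0 + J)
    (hF0 : ‖fordLaplace₀ g 0‖ ≤ F0)
    (Exc : Finset ℂ) (hExc : ∀ ρ ∈ Exc, f ρ = 0 ∧ 0 < ρ.re ∧ ρ.re < 1)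
    {B : ℝ} (hB : ∀ u : Finset ℂ, (∀ ρ ∈ u, f ρ = 0 ∧ 0 < ρ.re ∧ ρ.re < 1) →
      ∑ ρ ∈ u with ρ ∉ Exc, (analyticOrderNatAt f ρ : ℝ) * ‖fordLaplace g (-ρ)‖ ≤ B) :
    ‖Kv - main + ∑ ρ ∈ Exc, (analyticOrderNatAt f ρ : ℂ) * fordLaplace g (-ρ)‖ ≤
      B + (analyticOrderNatAt f 0 : ℝ) * F0 + ‖J‖ := by
  classical
  set a : nontrivialZeros f → ℂ := fun ρ ↦
    (analyticOrderNatAt f (ρ : ℂ) : ℂ) * fordLaplace₀ g (0 - (ρ : ℂ)) with ha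
  have ha_eq : ∀ ρ : nontrivialZeros f,
      a ρ = (analyticOrderNatAt f (ρ : ℂ) : ℂ) * fordLaplace g (-(ρ : ℂ)) := by
    intro ρ; rw [ha]; dsimp only; rw [zero_sub, fordLaplace₀_eq_fordLaplace hg0]
  have hna_eq : ∀ ρ : nontrivialZeros f,
      ‖a ρ‖ = (analyticOrderNatAt f (ρ : ℂ) : ℝ) * ‖fordLaplace g (-(ρ : ℂ))‖ := by
    intro ρ; rw [ha_eq, norm_mul, Complex.norm_natCast]
  -- split `a` into the exceptional and the non-exceptional part
  set aE : nontrivialZeros f → ℂ := fun ρ ↦ if (ρ : ℂ) ∈ Exc then a ρ else 0 with haE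
  set aN : nontrivialZeros f → ℂ := fun ρ ↦ if (ρ : ℂ) ∈ Exc then 0 else a ρ with haN
  have hsplit : ∀ ρ, a ρ = aE ρ + aN ρ := fun ρ ↦ by
    rw [haE, haN]; dsimp only; split_ifs <;> simp
  have hsum' : Summable a := hsum.of_norm
  have hEle : ∀ ρ, ‖aE ρ‖ ≤ ‖a ρ‖ := fun ρ ↦ by
    rw [haE]; dsimp only; split_ifs
    · exact le_rfl
    · rw [norm_zero]; exact norm_nonneg _
  have hNle : ∀ ρ, ‖aN ρ‖ ≤ ‖a ρ‖ := fun ρ ↦ by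
    rw [haN]; dsimp only; split_ifs
    · rw [norm_zero]; exact norm_nonneg _
    · exact le_rfl
  have hsumE : Summable aE := Summable.of_norm_bounded hsum hEle
  have hsumNn : Summable (fun ρ ↦ ‖aN ρ‖) := Summable.of_nonneg_of_le (fun _ ↦ norm_nonneg _) hNle hsum
  have hsumN : Summable aN := hsumNn.of_norm
  have htsum : ∑' ρ, a ρ = ∑' ρ, aE ρ + ∑' ρ, aN ρ := by
    rw [← hsumE.tsum_add hsumN]; exact tsum_congr hsplit
  -- the exceptional part is the finite sum over `Exc`
  set Exc' : Finset (nontrivialZeros f) := Exc.subtype (· ∈ nontrivialZeros f) with hExc'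
  have hEfin : ∑' ρ, aE ρ = ∑ ρ ∈ Exc, (analyticOrderNatAt f ρ : ℂ) * fordLaplace g (-ρ) := by
    rw [tsum_eq_sum (s := Exc') (fun ρ hρ ↦ ?_)]
    · have h1 : ∑ ρ ∈ Exc', aE ρ =
          ∑ ρ ∈ Exc', (fun ρ : ℂ ↦ (analyticOrderNatAt f ρ : ℂ) * fordLaplace g (-ρ)) (ρ : ℂ) := by
        refine Finset.sum_congr rfl fun ρ hρ ↦ ?_
        rw [hExc', Finset.mem_subtype] at hρ
        rw [haE]; dsimp only; rw [if_pos hρ, ha_eq]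
      rw [h1, hExc', Finset.sum_subtype_of_mem (p := (· ∈ nontrivialZeros f))
        (fun ρ : ℂ ↦ (analyticOrderNatAt f ρ : ℂ) * fordLaplace g (-ρ)) (fun ρ hρ ↦ hExc ρ hρ)]
    · rw [hExc', Finset.mem_subtype] at hρ
      rw [haE]; dsimp only; rw [if_neg hρ]
  -- the non-exceptional part is bounded by `B`
  have hNB : ‖∑' ρ, aN ρ‖ ≤ B := by
    refine (norm_tsum_le_tsum_norm hsumNn).trans (hsumNn.tsum_le_of_sum_le fun s ↦ ?_)
    have hinj : Set.InjOn (Subtype.val : nontrivialZeros f → ℂ) ↑s := fun a _ b _ h ↦ Subtype.ext h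
    have hBs := hB (s.image Subtype.val) (fun ρ hρ ↦ ?_)
    · refine le_trans (le_of_eq ?_) hBs
      rw [Finset.sum_filter, Finset.sum_image hinj]
      refine Finset.sum_congr rfl fun ρ _ ↦ ?_
      rw [haN]; dsimp only
      by_cases hmem : (ρ : ℂ) ∈ Exc
      · rw [if_pos hmem, if_neg (not_not.2 hmem), norm_zero]
      · rw [if_neg hmem, if_pos hmem, hna_eq]
    · obtain ⟨ρ', _, rfl⟩ := Finset.mem_image.1 hρ
      exact ρ'.2
  -- the trivial zero
  have hm₀ : ‖(analyticOrderNatAt f 0 : ℂ) * fordLaplace₀ g 0‖ ≤ (analyticOrderNatAt f 0 : ℝ) * F0 := by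
    rw [norm_mul, Complex.norm_natCast]
    exact mul_le_mul_of_nonneg_left hF0 (Nat.cast_nonneg _)
  -- assemble
  have hid : Kv - main + ∑ ρ ∈ Exc, (analyticOrderNatAt f ρ : ℂ) * fordLaplace g (-ρ) =
      -(∑' ρ, aN ρ) - (analyticOrderNatAt f 0 : ℂ) * fordLaplace₀ g 0 + J := by
    rw [hK, htsum, hEfin]; ring
  rw [hid]
  calc ‖-(∑' ρ, aN ρ) - (analyticOrderNatAt f 0 : ℂ) * fordLaplace₀ g 0 + J‖
      ≤ ‖-(∑' ρ, aN ρ) - (analyticOrderNatAt f 0 : ℂ) * fordLaplace₀ g 0‖ + ‖J‖ := norm_add_le _ _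
    _ ≤ ‖-(∑' ρ, aN ρ)‖ + ‖(analyticOrderNatAt f 0 : ℂ) * fordLaplace₀ g 0‖ + ‖J‖ :=
        add_le_add (norm_sub_le _ _) le_rfl
    _ ≤ B + (analyticOrderNatAt f 0 : ℝ) * F0 + ‖J‖ := by
        rw [norm_neg]; exact add_le_add (add_le_add hNB hm₀) le_rfl

/-! ### The instance for the family `F_ψ` -/

variable {K : Type} [Field K] [NumberField K]

/-- **The explicit formula of `F_ψ` read two-sidedly, exceptional zeros kept.**  For `ψ ∈ Ĉl_K`, `x > 1`,
`0 < ε < (log x)/2`, `g = tzTest (log x) ε`, a finite set `Exc` of non-trivial zeros of `F_ψ`, a bound `B`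
for the finite partial sums of `m_ψ ‖F(−ρ)‖` over the non-trivial zeros outside `Exc`, and bounds `M₀`, `J`
for the trivial-zero term `m_ψ(0)(log x + ε)` and the left-line integral:
`‖K_{χ_ψ}(g) − [ψ = 0] F(−1) + Σ_{ρ ∈ Exc} m_ψ(ρ) F(−ρ)‖ ≤ B + M₀ + J`.
[cite: ThornerZaman2019, §5 proof of Thm. 5.1 (explicit formulae of the family, smoothed class sums, exceptional zeros kept)] -/
theorem norm_coefFordK_famF_sub_le (ψ : AddChar (Additive (ClassGroup (𝓞 K))) ℂ) {x ε : ℝ}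
    (hx : 1 < x) (hε : 0 < ε) (hεL : ε < Real.log x / 2)
    (Exc : Finset ℂ) (hExc : ∀ ρ ∈ Exc, famF K ψ ρ = 0 ∧ 0 < ρ.re ∧ ρ.re < 1)
    {B M₀ J : ℝ}
    (hB : ∀ u : Finset ℂ, (∀ ρ ∈ u, famF K ψ ρ = 0 ∧ 0 < ρ.re ∧ ρ.re < 1) →
      ∑ ρ ∈ u with ρ ∉ Exc, (famMult K ψ ρ : ℝ) * ‖fordLaplace (tzTest (Real.log x) ε) (-ρ)‖ ≤ B)
    (hM₀ : (famMult K ψ 0 : ℝ) * (Real.log x + ε) ≤ M₀)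
    (hJ0 : ψ = 0 → ‖dzEFRemainder K (tzTest (Real.log x) ε) 0‖ ≤ J)
    (hJ : ψ ≠ 0 → ‖cgEFRemainder (toMulHom ψ).toHomUnits (tzTest (Real.log x) ε) 0‖ ≤ J) :
    ‖coefFordK (cgCoef (toMulHom ψ).toHomUnits) (tzTest (Real.log x) ε) 0 -
        (if ψ = 0 then fordLaplace (tzTest (Real.log x) ε) (-1) else 0) +
        ∑ ρ ∈ Exc, (famMult K ψ ρ : ℂ) * fordLaplace (tzTest (Real.log x) ε) (-ρ)‖ ≤
      B + M₀ + J := by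
  set Lx := Real.log x with hLx
  have hL : 0 < Lx := Real.log_pos hx
  have hadm := isSmoothedEFTest_tzTest hL hε
  have hg0 : tzTest Lx ε 0 = 0 := tzTest_zero hL hε hεL.le
  have hF0 : ‖fordLaplace₀ (tzTest Lx ε) 0‖ ≤ Lx + ε := by
    rw [fordLaplace₀_eq_fordLaplace hg0]; exact norm_fordLaplace_tzTest_zero_le hL hε hεL
  by_cases hψ : ψ = 0
  · -- `ψ = 0`: `F_0 = ζ₁_K`
    subst hψ
    simp only [if_true]
    have hsz : ∀ ρ : ℂ, dedekindZeta₁ K ρ = 0 → 0 < ρ.re → ρ.re < 1 → ρ ≠ 0 := by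
      intro ρ _ h1 _ h; rw [h] at h1; simp at h1
    have hexpl := coefFordK_one_eq_explicit (K := K) hadm hg0 (s := 0) (by norm_num) (by norm_num) hsz
    have hsum := summable_norm_dzZeroTerm (K := K) hadm (s := 0) (by norm_num) hsz
    have hExc' : ∀ ρ ∈ Exc, dedekindZeta₁ K ρ = 0 ∧ 0 < ρ.re ∧ ρ.re < 1 := by
      intro ρ hρ; have := hExc ρ hρ; rwa [famF_zero] at this
    have hB' : ∀ u : Finset ℂ, (∀ ρ ∈ u, dedekindZeta₁ K ρ = 0 ∧ 0 < ρ.re ∧ ρ.re < 1) →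
        ∑ ρ ∈ u with ρ ∉ Exc, (analyticOrderNatAt (dedekindZeta₁ K) ρ : ℝ) *
          ‖fordLaplace (tzTest Lx ε) (-ρ)‖ ≤ B := by
      intro u hu
      have := hB u (fun ρ hρ ↦ by rw [famF_zero]; exact hu ρ hρ)
      simpa only [famMult, famF_zero] using this
    have hmain : fordLaplace₀ (tzTest Lx ε) (0 - 1) = fordLaplace (tzTest Lx ε) (-1) := by
      rw [zero_sub, fordLaplace₀_eq_fordLaplace hg0]
    rw [hmain] at hexpl
    have key := norm_explicit_core hg0 hsum hexpl hF0 Exc hExc' hB'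
    have hm : (famMult K 0 0 : ℝ) = (analyticOrderNatAt (dedekindZeta₁ K) 0 : ℝ) := by
      rw [famMult, famF_zero]
    rw [hm] at hM₀
    have hJ' := hJ0 rfl
    have hcoef : coefFordK (cgCoef (toMulHom (0 : AddChar (Additive (ClassGroup (𝓞 K))) ℂ)).toHomUnits)
        (tzTest Lx ε) 0 = coefFordK (cgCoef (1 : ClassGroup (𝓞 K) →* ℂˣ)) (tzTest Lx ε) 0 := by
      rw [toHomUnits_toMulHom_zero]
    have hsumE : ∑ ρ ∈ Exc, (famMult K 0 ρ : ℂ) * fordLaplace (tzTest Lx ε) (-ρ) =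
        ∑ ρ ∈ Exc, (analyticOrderNatAt (dedekindZeta₁ K) ρ : ℂ) * fordLaplace (tzTest Lx ε) (-ρ) := by
      refine Finset.sum_congr rfl fun ρ _ ↦ ?_
      rw [famMult, famF_zero]
    rw [hcoef, hsumE]
    refine key.trans ?_
    have := mul_le_mul_of_nonneg_left hF0 (Nat.cast_nonneg (analyticOrderNatAt (dedekindZeta₁ K) 0))
    linarith
  · -- `ψ ≠ 0`: `F_ψ = L₀(·, χ_ψ)`
    simp only [hψ, if_false, sub_zero]
    set χ : ClassGroup (𝓞 K) →* ℂˣ := (toMulHom ψ).toHomUnits with hχdef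
    have hχ : χ ≠ 1 := toHomUnits_ne_one hψ
    have hsz : ∀ ρ : ℂ, classGroupLFunction₀ K χ ρ = 0 → 0 < ρ.re → ρ.re < 1 → ρ ≠ 0 := by
      intro ρ _ h1 _ h; rw [h] at h1; simp at h1
    have hexpl := coefFordK_eq_explicit hχ hadm hg0 (s := 0) (by norm_num) (by norm_num) hsz
    have hsum := summable_norm_cgZeroTerm hχ hadm (s := 0) (by norm_num) hsz
    have hExc' : ∀ ρ ∈ Exc, classGroupLFunction₀ K χ ρ = 0 ∧ 0 < ρ.re ∧ ρ.re < 1 := by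
      intro ρ hρ; have := hExc ρ hρ; rwa [famF_of_ne hψ] at this
    have hB' : ∀ u : Finset ℂ, (∀ ρ ∈ u, classGroupLFunction₀ K χ ρ = 0 ∧ 0 < ρ.re ∧ ρ.re < 1) →
        ∑ ρ ∈ u with ρ ∉ Exc, (analyticOrderNatAt (classGroupLFunction₀ K χ) ρ : ℝ) *
          ‖fordLaplace (tzTest Lx ε) (-ρ)‖ ≤ B := by
      intro u hu
      have := hB u (fun ρ hρ ↦ by rw [famF_of_ne hψ]; exact hu ρ hρ)
      simpa only [famMult, famF_of_ne hψ] using this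
    have hexpl' : coefFordK (cgCoef χ) (tzTest Lx ε) 0 = 0 -
        (∑' ρ : nontrivialZeros (classGroupLFunction₀ K χ),
          (analyticOrderNatAt (classGroupLFunction₀ K χ) (ρ : ℂ) : ℂ) * fordLaplace₀ (tzTest Lx ε) (0 - ρ)) -
        (analyticOrderNatAt (classGroupLFunction₀ K χ) 0 : ℂ) * fordLaplace₀ (tzTest Lx ε) 0 +
        cgEFRemainder χ (tzTest Lx ε) 0 := by
      rw [hexpl]; ring
    have key := norm_explicit_core hg0 hsum hexpl' hF0 Exc hExc' hB'
    have hm : (famMult K ψ 0 : ℝ) = (analyticOrderNatAt (classGroupLFunction₀ K χ) 0 : ℝ) := by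
      rw [famMult, famF_of_ne hψ]
    rw [hm] at hM₀
    have hJ' := hJ hψ
    have hsumE : ∑ ρ ∈ Exc, (famMult K ψ ρ : ℂ) * fordLaplace (tzTest Lx ε) (-ρ) =
        ∑ ρ ∈ Exc, (analyticOrderNatAt (classGroupLFunction₀ K χ) ρ : ℂ) * fordLaplace (tzTest Lx ε) (-ρ) := by
      refine Finset.sum_congr rfl fun ρ _ ↦ ?_
      rw [famMult, famF_of_ne hψ]
    rw [hsumE]
    rw [sub_zero] at key
    refine key.trans ?_
    have := mul_le_mul_of_nonneg_left hF0 (Nat.cast_nonneg (analyticOrderNatAt (classGroupLFunction₀ K χ) 0))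
    linarith

/-! ### From the family bound for finite partial sums to the sum of the suprema -/

/-- **Supremum lemma.**  For a finite index type `ι`, a nonempty type `σ` and `P : ι → σ → ℝ` with
`Σ_i P i (u i) ≤ B` for every `u : ι → σ`: `Σ_i ⨆_u P i u ≤ B` (each `P i` is then bounded above).
[cite: ThornerZaman2019, §5 proof of Thm. 5.1 (explicit formulae of the family, smoothed class sums, exceptional zeros kept)] -/
theorem sum_ciSup_le_of_forall_sum_le {ι σ : Type*} [Fintype ι] [Nonempty σ] (P : ι → σ → ℝ)
    (hP0 : ∀ i u, 0 ≤ P i u) {B : ℝ} (hB : ∀ u : ι → σ, ∑ i, P i (u i) ≤ B) :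
    ∑ i, ⨆ u, P i u ≤ B := by
  classical
  obtain ⟨u₀⟩ := ‹Nonempty σ›
  -- each `P i` is bounded above by `B`
  have hbdd : ∀ i, BddAbove (Set.range (P i)) := by
    intro i
    refine ⟨B, ?_⟩
    rintro _ ⟨u, rfl⟩
    have h := hB (Function.update (fun _ ↦ u₀) i u)
    have hle : P i u ≤ ∑ j, P j (Function.update (fun _ ↦ u₀) i u j) := by
      rw [← Finset.sum_erase_add _ _ (Finset.mem_univ i)]
      simp only [Function.update_self]
      have : 0 ≤ ∑ j ∈ Finset.univ.erase i, P j (Function.update (fun _ ↦ u₀) i u j) :=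
        Finset.sum_nonneg fun j _ ↦ hP0 _ _
      linarith
    exact hle.trans h
  refine le_of_forall_pos_le_add fun δ hδ ↦ ?_
  -- choose, for each `i`, an almost-maximiser
  have hδ' : 0 < δ / (Fintype.card ι + 1) := by positivity
  have hchoice : ∀ i, ∃ u, ⨆ v, P i v ≤ P i u + δ / (Fintype.card ι + 1) := by
    intro i
    have hlt : (⨆ v, P i v) - δ / (Fintype.card ι + 1) < ⨆ v, P i v := by linarith
    obtain ⟨u, hu⟩ := exists_lt_of_lt_ciSup hlt
    exact ⟨u, by linarith⟩
  choose u hu using hchoice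
  calc ∑ i, ⨆ v, P i v ≤ ∑ i, (P i (u i) + δ / (Fintype.card ι + 1)) := Finset.sum_le_sum fun i _ ↦ hu i
    _ = ∑ i, P i (u i) + Fintype.card ι * (δ / (Fintype.card ι + 1)) := by
        rw [Finset.sum_add_distrib, Finset.sum_const, nsmul_eq_mul, Finset.card_univ]
    _ ≤ B + δ := by
        have h1 := hB u
        have h2 : (Fintype.card ι : ℝ) * (δ / (Fintype.card ι + 1)) ≤ δ := by
          rw [mul_div_assoc', div_le_iff₀ (by positivity)]; nlinarith
        linarith

/-! ### The assembly over the family -/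

set_option maxHeartbeats 800000 in
/-- **The smoothed class sum through the family, two-sided, exceptional zeros kept.**  For `x > 1`,
`0 < ε < (log x)/2`, `g = tzTest (log x) ε`, a class `C`, finite sets `Exc ψ` of non-trivial zeros of
`F_ψ` containing all those in the exceptional segment `excRegion c K`, a FAMILY bound `Bf` for the finite
partial sums of the zero terms off the segment (the conclusion of `fam_zeroSum_le_local`), and bounds `M₀`,
`J` for the trivial-zero terms and the left-line integrals of every member:
`‖h ψ̃_C(g) − F(−1) + Σ_ψ ψ(C⁻¹) Σ_{ρ ∈ Exc ψ} m_ψ(ρ) F(−ρ)‖ ≤ Bf + h (M₀ + J)`.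
[cite: ThornerZaman2019, §5 proof of Thm. 5.1 (explicit formulae of the family, smoothed class sums, exceptional zeros kept)] -/
theorem norm_classNumber_mul_smoothedPsiClass_sub_le {x ε c : ℝ} (hx : 1 < x) (hε : 0 < ε)
    (hεL : ε < Real.log x / 2) (C : ClassGroup (𝓞 K))
    (Exc : AddChar (Additive (ClassGroup (𝓞 K))) ℂ → Finset ℂ)
    (hExc : ∀ ψ, ∀ ρ ∈ Exc ψ, famF K ψ ρ = 0 ∧ 0 < ρ.re ∧ ρ.re < 1)
    (hExc' : ∀ ψ ρ, famF K ψ ρ = 0 → 0 < ρ.re → ρ.re < 1 → excRegion c K ρ → ρ ∈ Exc ψ)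
    {Bf M₀ J : ℝ}
    (hBf : ∀ u : AddChar (Additive (ClassGroup (𝓞 K))) ℂ → Finset ℂ,
        (∀ ψ, ∀ ρ ∈ u ψ, famF K ψ ρ = 0 ∧ 0 < ρ.re ∧ ρ.re < 1) →
        ∑ ψ, ∑ ρ ∈ u ψ with ¬ excRegion c K ρ,
            (famMult K ψ ρ : ℝ) * ‖fordLaplace (tzTest (Real.log x) ε) (-ρ)‖ ≤ Bf)
    (hM₀ : ∀ ψ, (famMult K ψ 0 : ℝ) * (Real.log x + ε) ≤ M₀)
    (hJ0 : ‖dzEFRemainder K (tzTest (Real.log x) ε) 0‖ ≤ J)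
    (hJ : ∀ ψ : AddChar (Additive (ClassGroup (𝓞 K))) ℂ, ψ ≠ 0 →
      ‖cgEFRemainder (toMulHom ψ).toHomUnits (tzTest (Real.log x) ε) 0‖ ≤ J) :
    ‖(NumberField.classNumber K : ℂ) * (smoothedPsiClass K C (tzTest (Real.log x) ε) : ℂ) -
        fordLaplace (tzTest (Real.log x) ε) (-1) +
        ∑ ψ : AddChar (Additive (ClassGroup (𝓞 K))) ℂ, ψ (Additive.ofMul C⁻¹) *
          ∑ ρ ∈ Exc ψ, (famMult K ψ ρ : ℂ) * fordLaplace (tzTest (Real.log x) ε) (-ρ)‖ ≤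
      Bf + (NumberField.classNumber K : ℝ) * (M₀ + J) := by
  classical
  set Lx := Real.log x with hLx
  have hL : 0 < Lx := Real.log_pos hx
  set g := tzTest Lx ε with hg
  have hg0' : ∀ u, Lx + ε ≤ u → g u = 0 := fun u hu ↦ tzTest_eq_zero_of_ge hL hε hu
  -- the per-character suprema
  set P : AddChar (Additive (ClassGroup (𝓞 K))) ℂ → Finset ℂ → ℝ := fun ψ u ↦
    ∑ ρ ∈ u with ((famF K ψ ρ = 0 ∧ 0 < ρ.re ∧ ρ.re < 1) ∧ ρ ∉ Exc ψ),
      (famMult K ψ ρ : ℝ) * ‖fordLaplace g (-ρ)‖ with hP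
  have hP0 : ∀ ψ u, 0 ≤ P ψ u := fun ψ u ↦
    Finset.sum_nonneg fun ρ _ ↦ mul_nonneg (Nat.cast_nonneg _) (norm_nonneg _)
  have hPB : ∀ u : AddChar (Additive (ClassGroup (𝓞 K))) ℂ → Finset ℂ, ∑ ψ, P ψ (u ψ) ≤ Bf := by
    intro u
    have h := hBf (fun ψ ↦ (u ψ).filter (fun ρ ↦ famF K ψ ρ = 0 ∧ 0 < ρ.re ∧ ρ.re < 1))
      (fun ψ ρ hρ ↦ (Finset.mem_filter.1 hρ).2)
    refine le_trans (Finset.sum_le_sum fun ψ _ ↦ ?_) h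
    rw [hP]; dsimp only
    rw [Finset.filter_filter]
    refine Finset.sum_le_sum_of_subset_of_nonneg (fun ρ hρ ↦ ?_)
      fun ρ _ _ ↦ mul_nonneg (Nat.cast_nonneg _) (norm_nonneg _)
    rw [Finset.mem_filter] at hρ ⊢
    refine ⟨hρ.1, hρ.2.1, fun hexc ↦ hρ.2.2 (hExc' ψ ρ hρ.2.1.1 hρ.2.1.2.1 hρ.2.1.2.2 hexc)⟩
  have hsup := sum_ciSup_le_of_forall_sum_le P hP0 hPB
  have hbdd : ∀ ψ, BddAbove (Set.range (P ψ)) := by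
    intro ψ
    refine ⟨Bf, ?_⟩
    rintro _ ⟨u, rfl⟩
    have h := hPB (Function.update (fun _ ↦ (∅ : Finset ℂ)) ψ u)
    have hle : P ψ u ≤ ∑ φ, P φ (Function.update (fun _ ↦ (∅ : Finset ℂ)) ψ u φ) := by
      rw [← Finset.sum_erase_add _ _ (Finset.mem_univ ψ)]
      simp only [Function.update_self]
      have : 0 ≤ ∑ φ ∈ Finset.univ.erase ψ, P φ (Function.update (fun _ ↦ (∅ : Finset ℂ)) ψ u φ) :=
        Finset.sum_nonneg fun φ _ ↦ hP0 _ _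
      linarith
    exact hle.trans h
  -- the per-character estimate with `B_ψ = ⨆_u P ψ u`
  have hper : ∀ ψ : AddChar (Additive (ClassGroup (𝓞 K))) ℂ,
      ‖coefFordK (cgCoef (toMulHom ψ).toHomUnits) g 0 - (if ψ = 0 then fordLaplace g (-1) else 0) +
          ∑ ρ ∈ Exc ψ, (famMult K ψ ρ : ℂ) * fordLaplace g (-ρ)‖ ≤ (⨆ u, P ψ u) + M₀ + J := by
    intro ψ
    refine norm_coefFordK_famF_sub_le ψ hx hε hεL (Exc ψ) (hExc ψ) (fun u hu ↦ ?_) (hM₀ ψ)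
      (fun _ ↦ hJ0) (fun h0 ↦ hJ ψ h0)
    refine le_trans (le_of_eq ?_) (le_ciSup (hbdd ψ) u)
    rw [hP]; dsimp only
    refine Finset.sum_congr (Finset.filter_congr fun ρ hρ ↦ ?_) fun _ _ ↦ rfl
    exact ⟨fun h ↦ ⟨hu ρ hρ, h⟩, fun h ↦ h.2⟩
  -- orthogonality
  have horth := classNumber_mul_smoothedPsiClass (K := K) C hg0'
  have hmain : ∑ ψ : AddChar (Additive (ClassGroup (𝓞 K))) ℂ,
      ψ (Additive.ofMul C⁻¹) * (if ψ = 0 then fordLaplace g (-1) else 0) = fordLaplace g (-1) := by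
    rw [Finset.sum_eq_single (0 : AddChar (Additive (ClassGroup (𝓞 K))) ℂ)]
    · rw [if_pos rfl, AddChar.zero_apply, one_mul]
    · intro ψ _ hψ; rw [if_neg hψ, mul_zero]
    · intro h; exact absurd (Finset.mem_univ _) h
  have hid : (NumberField.classNumber K : ℂ) * (smoothedPsiClass K C g : ℂ) - fordLaplace g (-1) +
      ∑ ψ : AddChar (Additive (ClassGroup (𝓞 K))) ℂ, ψ (Additive.ofMul C⁻¹) *
        ∑ ρ ∈ Exc ψ, (famMult K ψ ρ : ℂ) * fordLaplace g (-ρ) =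
      ∑ ψ : AddChar (Additive (ClassGroup (𝓞 K))) ℂ, ψ (Additive.ofMul C⁻¹) *
        (coefFordK (cgCoef (toMulHom ψ).toHomUnits) g 0 - (if ψ = 0 then fordLaplace g (-1) else 0) +
          ∑ ρ ∈ Exc ψ, (famMult K ψ ρ : ℂ) * fordLaplace g (-ρ)) := by
    rw [horth]
    simp only [mul_add, mul_sub, Finset.sum_add_distrib, Finset.sum_sub_distrib, hmain]
  rw [hid]
  calc ‖∑ ψ : AddChar (Additive (ClassGroup (𝓞 K))) ℂ, ψ (Additive.ofMul C⁻¹) *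
        (coefFordK (cgCoef (toMulHom ψ).toHomUnits) g 0 - (if ψ = 0 then fordLaplace g (-1) else 0) +
          ∑ ρ ∈ Exc ψ, (famMult K ψ ρ : ℂ) * fordLaplace g (-ρ))‖
      ≤ ∑ ψ : AddChar (Additive (ClassGroup (𝓞 K))) ℂ, ‖ψ (Additive.ofMul C⁻¹) *
        (coefFordK (cgCoef (toMulHom ψ).toHomUnits) g 0 - (if ψ = 0 then fordLaplace g (-1) else 0) +
          ∑ ρ ∈ Exc ψ, (famMult K ψ ρ : ℂ) * fordLaplace g (-ρ))‖ := norm_sum_le _ _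
    _ ≤ ∑ ψ : AddChar (Additive (ClassGroup (𝓞 K))) ℂ, ((⨆ u, P ψ u) + M₀ + J) := by
        refine Finset.sum_le_sum fun ψ _ ↦ ?_
        rw [norm_mul, norm_addChar_apply, one_mul]
        exact hper ψ
    _ = ∑ ψ : AddChar (Additive (ClassGroup (𝓞 K))) ℂ, (⨆ u, P ψ u) +
          (NumberField.classNumber K : ℝ) * (M₀ + J) := by
        rw [Finset.sum_add_distrib, Finset.sum_add_distrib, Finset.sum_const, Finset.sum_const,
          nsmul_eq_mul, nsmul_eq_mul, Finset.card_univ, card_addChar_classGroup]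
        ring
    _ ≤ Bf + (NumberField.classNumber K : ℝ) * (M₀ + J) := add_le_add hsup le_rfl

end Literature.NumberTheory.LFunctions.NumberField.ClassPNT

end Part4

/-!
## Part 5 — port of `Summits/QuantumAdvantage/QuantumAdvantage/Theorems/LinnikCubicClassGroupsDegreeOnePrimesEscapeLowerPITSmoothedAux.lean` (2 declarations kept)

# Auxiliary estimates for the one-sided lower prime ideal theorem (T5): the Landau–Page region in
# `Q`-form, the trivial zero and the left line for `ζ₁_K`, and the numerics of the exceptional term

* `lpRegion_of_not_good` — a zero outside `β ≤ 1 − c/(a log Q + log(|γ|+4))` (`0 < c ≤ c₀`, `a ≥ 1`) lies in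
  the Landau–Page region `β > 1 − c₀/(log|d_K| + log(|γ|+4))`;
* `trivialZero_term_le_one`, `leftLine_term_le_one` — the `ζ₁_K` twins of the sibling's
  `trivialZero_term_le` / `leftLine_term_le` (`m₀(L+ε) ≤ 1152 e^{L/4}`, `‖J₁(0)‖ ≤ 8·leftLineConst·Al(n+1)M`),
  from `analyticOrderNatAt_dedekindZeta₁_zero_le` and `norm_dzEFRemainder_tzTest_zero_le`;
* `exp_four_ge`, `exp_six_ge`, `integral_exp_mul_le_div` — `∫_{L/2}^{L} e^{βu} du ≤ e^L/50` for
  `β ≥ 15/16`, `(1 − β)L ≥ 4`.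
-/

section Part5

open _root_.Complex _root_.Real _root_.MeasureTheory _root_.Set _root_.Filter _root_.Topology
open scoped _root_.NumberField nonZeroDivisors
open Literature.NumberTheory.LFunctions Literature.NumberTheory.LFunctions.NumberField
  Literature.NumberTheory.LFunctions.EntireEF Literature.NumberTheory.LFunctions.TZWeight

namespace Literature.NumberTheory.LFunctions.NumberField.ClassPNT

/-! ### The Landau–Page region contains the complement of the `Q`-form zero-free region -/

/-- The trivial zero: `m₀ (L + ε) ≤ 1152 e^{L/4}` for `ζ₁_K`, `K` of degree `n > 1`, `Q ≤ e^{L/8}`,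
`0 ≤ ε ≤ 1 ≤ L` (`m₀ ≤ 8(log|d_K| + 6n + 3) ≤ 72 Q`, `L ≤ 8e^{L/8}`).
[cite: ThornerZaman2019, Thm. 3.1 (Landau–Page region in Q-form) and §5 (trivial zero, left line, exceptional-term numerics)] -/
theorem trivialZero_term_le_one (K : Type) [Field K] [NumberField K] (hK : 1 < Module.finrank ℚ K)
    {L ε : ℝ} (hL : 1 ≤ L) (hε0 : 0 ≤ ε) (hε1 : ε ≤ 1)
    (hQexp : ThornerZaman.condQn K ≤ Real.exp (L / 8)) :
    (analyticOrderNatAt (dedekindZeta₁ K) 0 : ℝ) * (L + ε) ≤ 1152 * Real.exp (L / 4) := by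
  set Q := ThornerZaman.condQn K with hQ
  have hQ12 : (12 : ℝ) ≤ Q := ThornerZaman.twelve_le_condQn (K := K) hK
  have hm₀ := analyticOrderNatAt_dedekindZeta₁_zero_le (K := K)
  obtain ⟨-, hlogd⟩ := log_natAbs_discr_mem K
  have hnQ : (Module.finrank ℚ K : ℝ) ≤ Q := ThornerZaman.finrank_le_condQn (K := K)
  have h1 : 8 * (Real.log ((NumberField.discr K).natAbs : ℝ) + 6 * Module.finrank ℚ K + 3) ≤ 72 * Q := by
    rw [← hQ] at hlogd; linarith
  have h2 : L + ε ≤ 2 * L := by linarith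
  have h3 : (analyticOrderNatAt (dedekindZeta₁ K) 0 : ℝ) * (L + ε) ≤ 72 * Q * (2 * L) :=
    mul_le_mul (hm₀.trans h1) h2 (by linarith) (by positivity)
  have hL8 := le_eight_mul_exp_div L
  have hee : Real.exp (L / 8) * Real.exp (L / 8) = Real.exp (L / 4) := by
    rw [← Real.exp_add]; ring_nf
  have h4 : Q * L ≤ Real.exp (L / 8) * (8 * Real.exp (L / 8)) :=
    mul_le_mul hQexp hL8 (by linarith) (Real.exp_pos _).le
  nlinarith [Real.exp_pos (L / 8)]

/-- The left-line integral for `ζ_K`: with the constant `Al` of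
`exists_norm_logDeriv_classGroupLFunction_left_le` and the smooth-transition bound `M`,
`‖J₁(0)‖ ≤ 8 · leftLineConst · Al (n + 1) M` for `g = tzTest L ε`, `ε = e^{−νL}`, `0 < ν ≤ 1/64`,
`Q ≤ e^{L/8}`, `0 < ε < L/2`, `ε ≤ 1`.
[cite: ThornerZaman2019, Thm. 3.1 (Landau–Page region in Q-form) and §5 (trivial zero, left line, exceptional-term numerics)] -/
theorem leftLine_term_le_one {Al : ℝ} (hAl0 : 0 < Al)
    (hAl : ∀ (K : Type) [Field K] [NumberField K] (χ : ClassGroup (𝓞 K) →* ℂˣ) (t : ℝ),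
      ‖logDeriv (classGroupLFunction K χ) (-1 / 2 + t * I)‖ ≤
        Al * (Module.finrank ℚ K + 1) * (Real.log ((NumberField.discr K).natAbs : ℝ) + Real.log (|t| + 4)))
    {M : ℝ} (hM : ∀ y : ℝ, |iteratedDeriv 1 Real.smoothTransition y| ≤ M ∧
      |iteratedDeriv 2 Real.smoothTransition y| ≤ M)
    (K : Type) [Field K] [NumberField K] (hK : 1 < Module.finrank ℚ K)
    {L ε ν : ℝ} (hL : 0 < L) (hε : 0 < ε) (hεL : ε < L / 2)
    (hε1 : ε ≤ 1) (hν64 : ν ≤ 1 / 64) (hεexp : ε = Real.exp (-(ν * L)))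
    (hQexp : ThornerZaman.condQn K ≤ Real.exp (L / 8)) :
    ‖dzEFRemainder K (tzTest L ε) 0‖ ≤ 8 * leftLineConst * Al * (Module.finrank ℚ K + 1) * M := by
  have hJ := norm_dzEFRemainder_tzTest_zero_le (K := K) hAl0 hAl hM hL hε hεL
  have hM0 : 0 ≤ M := le_trans (abs_nonneg _) (hM 0).1
  have hlC := leftLineConst_nonneg
  set Q := ThornerZaman.condQn K with hQ
  have hQ12 : (12 : ℝ) ≤ Q := ThornerZaman.twelve_le_condQn (K := K) hK
  obtain ⟨hlogd0, hlogd⟩ := log_natAbs_discr_mem K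
  have hlogd4 : Real.log ((NumberField.discr K).natAbs : ℝ) + Real.log 4 + 1 ≤ 2 * Q := by
    have hlog4 : Real.log 4 ≤ 2 := by
      have : Real.log 4 = 2 * Real.log 2 := by
        rw [show (4:ℝ) = 2 ^ 2 by norm_num, Real.log_pow]; norm_num
      rw [this]; have := Real.log_two_lt_d9; linarith
    rw [← hQ] at hlogd; linarith
  have hexp1 : Real.exp (-(L / 4) + ε / 2) ≤ 2 * Real.exp (-(L / 4)) := by
    rw [Real.exp_add, mul_comm]
    refine mul_le_mul_of_nonneg_right ?_ (Real.exp_pos _).le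
    have hsq : Real.exp (ε / 2) ^ 2 < 2 ^ 2 := by
      rw [← Real.exp_nat_mul]
      have h1 : Real.exp ((2 : ℕ) * (ε / 2)) ≤ Real.exp 1 := Real.exp_le_exp.2 (by push_cast; linarith)
      have := Real.exp_one_lt_d9; linarith
    exact (lt_of_pow_lt_pow_left₀ 2 (by norm_num) hsq).le
  have hexp2 : 2 * M / ε ≤ 2 * M * Real.exp (L / 64) := by
    rw [hεexp, div_eq_mul_inv, ← Real.exp_neg, neg_neg]
    refine mul_le_mul_of_nonneg_left (Real.exp_le_exp.2 ?_) (by positivity)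
    nlinarith
  have hlog40 : 0 ≤ Real.log 4 := Real.log_nonneg (by norm_num)
  have hprod : (Real.log ((NumberField.discr K).natAbs : ℝ) + Real.log 4 + 1) *
      (Real.exp (-(L / 4) + ε / 2) * (2 * M / ε)) ≤ 8 * M := by
    calc (Real.log ((NumberField.discr K).natAbs : ℝ) + Real.log 4 + 1) *
          (Real.exp (-(L / 4) + ε / 2) * (2 * M / ε))
        ≤ (2 * Q) * ((2 * Real.exp (-(L / 4))) * (2 * M * Real.exp (L / 64))) :=
          mul_le_mul hlogd4 (mul_le_mul hexp1 hexp2 (by positivity) (by positivity))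
            (by positivity) (by positivity)
      _ ≤ (2 * Real.exp (L / 8)) * ((2 * Real.exp (-(L / 4))) * (2 * M * Real.exp (L / 64))) :=
          mul_le_mul_of_nonneg_right (by linarith) (by positivity)
      _ = 8 * M * Real.exp (L / 8 + -(L / 4) + L / 64) := by
          rw [Real.exp_add, Real.exp_add]; ring
      _ ≤ 8 * M * 1 := by
          refine mul_le_mul_of_nonneg_left ?_ (by positivity)
          rw [Real.exp_le_one_iff]; nlinarith
      _ = 8 * M := mul_one _
  refine hJ.trans ?_
  rw [mul_assoc (leftLineConst * (Al * ((Module.finrank ℚ K : ℝ) + 1)))]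
  calc leftLineConst * (Al * ((Module.finrank ℚ K : ℝ) + 1)) *
        ((Real.log ((NumberField.discr K).natAbs : ℝ) + Real.log 4 + 1) *
          (Real.exp (-(L / 4) + ε / 2) * (2 * M / ε)))
      ≤ leftLineConst * (Al * ((Module.finrank ℚ K : ℝ) + 1)) * (8 * M) :=
        mul_le_mul_of_nonneg_left hprod (by positivity)
    _ = _ := by ring

/-! ### Numerics -/

end Literature.NumberTheory.LFunctions.NumberField.ClassPNT

end Part5

/-!
## Part 6 — port of `Summits/QuantumAdvantage/QuantumAdvantage/Theorems/LinnikCubicClassGroupsDegreeOnePrimesEscapeClassPNTSmoothedMain.lean` (3 declarations kept)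

# The additive class prime number theorem, IV: the smoothed class sums, two-sided, with the
# (at most one) exceptional zero of the family — the dichotomy, with constants

For the number fields `K` of one degree `n > 1` whose family `F_ψ` obeys the log-free density bound in
`Q`-form (constants `b, D, a`; the shape of `fam_density_local`), and every `η > 0`, there are `ν, a₁, c > 0`
such that for every such `K`, with `g_x = tzTest (log x) x^{−ν}`, `F_x` its Laplace transform, `h = h_K`:
EITHER for all `x ≥ Q^{a₁}` and all classes `C`, `‖h ψ̃_C(g_x) − F_x(−1)‖ ≤ η x`; OR there are `ψ₁ ∈ Ĉl_K`
(`χ_{ψ₁}` real) and a real zero `β₁ ∈ (1 − c/(log|d_K| + log 4), 1)` of `F_{ψ₁}` with, for all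
`x ≥ Q^{a₁}` and all `C`, `‖h ψ̃_C(g_x) − F_x(−1) + ψ₁(C⁻¹) F_x(−β₁)‖ ≤ η x`
(`smoothedClassSum_dichotomy`).  The constant `c ≤ 1/(8(n² + 1))` is chosen so small that the exceptional
zero automatically lies in `(1 − 1/(8 log Q), 1)` (used downstream).  Ingredients: `fam_zeroSum_le_local`,
`norm_classNumber_mul_smoothedPsiClass_sub_le`, the Landau–Page package `exists_exceptionalZero_const`
(reality, uniqueness, simplicity), `trivialZero_term_le(_one)`, `leftLine_term_le(_one)`, `zeroSum_main_small`.
-/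

section Part6

open _root_.Complex _root_.Real _root_.MeasureTheory _root_.Set _root_.Filter _root_.Topology
open scoped _root_.NumberField nonZeroDivisors

namespace Literature.NumberTheory.LFunctions.NumberField.ClassPNT

open Literature.NumberTheory.LFunctions Literature.NumberTheory.LFunctions.NumberField
  Literature.NumberTheory.LFunctions.EntireEF Literature.NumberTheory.LFunctions.TZWeight
  Literature.NumberTheory.LFunctions.AbelianDensity

variable {K : Type} [Field K] [NumberField K]

/-! ### Small lemmas on the family -/

/-- A zero of `F_ψ` is a zero of the `χ_ψ`-factor in the sense of the Landau–Page package.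
[cite: ThornerZaman2019, Thm. 3.1 with §5 (smoothed class sums: the dichotomy with at most one exceptional zero)] -/
theorem famZ_of_famF_eq_zero (ψ : AddChar (Additive (ClassGroup (𝓞 K))) ℂ) {ρ : ℂ} (h0 : famF K ψ ρ = 0) :
    ((toMulHom ψ).toHomUnits = 1 → dedekindZeta₁ K ρ = 0) ∧
      ((toMulHom ψ).toHomUnits ≠ 1 → classGroupLFunction₀ K (toMulHom ψ).toHomUnits ρ = 0) := by
  refine ⟨fun h1 ↦ ?_, fun h1 ↦ ?_⟩
  · have hψ : ψ = 0 := by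
      by_contra hψ; exact toHomUnits_ne_one hψ h1
    subst hψ; rwa [famF_zero] at h0
  · have hψ : ψ ≠ 0 := fun h ↦ h1 (by rw [h]; exact toHomUnits_toMulHom_zero)
    rwa [famF_of_ne hψ] at h0

/-- Monotonicity of the Landau–Page region in the constant: `1 − c/ℒ < β` and `c ≤ c₀` give `1 − c₀/ℒ < β`
(`ℒ = log|d_K| + log(|γ| + 4) > 0`).
[cite: ThornerZaman2019, Thm. 3.1 with §5 (smoothed class sums: the dichotomy with at most one exceptional zero)] -/
theorem lpRegion_mono {c c₀ : ℝ} (hcc₀ : c ≤ c₀) {ρ : ℂ}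
    (h : 1 - c / (Real.log ((NumberField.discr K).natAbs : ℝ) + Real.log (|ρ.im| + 4)) < ρ.re) :
    1 - c₀ / (Real.log ((NumberField.discr K).natAbs : ℝ) + Real.log (|ρ.im| + 4)) < ρ.re := by
  have hlog4 : 0 < Real.log (|ρ.im| + 4) := Real.log_pos (by linarith [abs_nonneg ρ.im])
  have hlogd : 0 ≤ Real.log ((NumberField.discr K).natAbs : ℝ) := Real.log_natCast_nonneg _
  have := div_le_div_of_nonneg_right hcc₀ (by linarith : 0 ≤ Real.log ((NumberField.discr K).natAbs : ℝ) +
    Real.log (|ρ.im| + 4))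
  linarith

/-- The trivial-zero term of every member: `m_ψ(0)(L + ε) ≤ 1152 e^{L/4}` (`Q ≤ e^{L/8}`, `0 ≤ ε ≤ 1 ≤ L`).
[cite: ThornerZaman2019, Thm. 3.1 with §5 (smoothed class sums: the dichotomy with at most one exceptional zero)] -/
theorem famMult_zero_term_le (hK : 1 < Module.finrank ℚ K) (ψ : AddChar (Additive (ClassGroup (𝓞 K))) ℂ)
    {L ε : ℝ} (hL : 1 ≤ L) (hε0 : 0 ≤ ε) (hε1 : ε ≤ 1) (hQexp : ThornerZaman.condQn K ≤ Real.exp (L / 8)) :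
    (famMult K ψ 0 : ℝ) * (L + ε) ≤ 1152 * Real.exp (L / 4) := by
  by_cases hψ : ψ = 0
  · subst hψ; rw [famMult, famF_zero]; exact trivialZero_term_le_one K hK hL hε0 hε1 hQexp
  · rw [famMult, famF_of_ne hψ]; exact trivialZero_term_le K hK (toHomUnits_ne_one hψ) hL hε0 hε1 hQexp

/-! ### The dichotomy -/

end Literature.NumberTheory.LFunctions.NumberField.ClassPNT

end Part6

/-!
## Part 7 — port of `Summits/QuantumAdvantage/QuantumAdvantage/Theorems/LinnikCubicClassGroupsDegreeOnePrimesEscapeClassPNTDHSmoothedDecayCore.lean` (2 declarations kept)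

# The class prime number theorem with DECAYING error, II: the core estimate for the smoothed class sums

`smoothedClassSum_decay_core` isolates the estimate `hcore` inside the proof of
`smoothedClassSum_dichotomy_dh` (`…ClassPNTDHSmoothed.lean`) as a theorem with the zero-free constant `c_Z`
off the exceptional segment as a PARAMETER and WITHOUT any target accuracy: for a number field `K` of degree
`n` obeying the family density bound in `Q`-form, `x ≥ Q^{a_C}`, `g_x = tzTest (log x) x^{−ν}`, a class `C`,
finite sets `Exc ψ` of non-trivial zeros containing all zeros on `excRegion c K`, and `c_Z > 0` such that every
zero off the segment with `1/4 ≤ β < 1`, `|γ| ≤ x` has `β ≤ 1 − c_Z/(a log Q + log(|γ| + 4))`: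

  `‖h ψ̃_C(g_x) − F(−1) + Σ_ψ ψ(C⁻¹) Σ_{ρ ∈ Exc ψ} m_ψ(ρ) F(−ρ)‖
      ≤ x · A₀ (e^{−c_Z L/(4a log Q)} + e^{−√(c_Z L/4)}) + A_J x^{1−ν}`,     `L = log x`,

with `ν, a_C, A₀, A_J` depending on `n, b, D, a` only (`fam_zeroSum_le_local_zfr` for the zeros off the
segment, `norm_classNumber_mul_smoothedPsiClass_sub_le` for the explicit formula of the family, the
trivial-zero and left-line bounds `famMult_zero_term_le`, `leftLine_term_le(_one)`, and `h_K ≤ Q⁴ ≤ x^{1/8}`).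
It is the common first step of the `η`-form (gen 4) and of the decaying form (gen 32,
`…ClassPNTDHSmoothedDecay.lean`) of [ThornerZaman2019, Thm. 1.4 / §5].
References: J. Thorner, A. Zaman, Algebra Number Theory 13 (2019), §4–5 [ThornerZaman2019];
J. C. Lagarias, H. L. Montgomery, A. M. Odlyzko, Invent. Math. 54 (1979), §7 [LagariasMontgomeryOdlyzko1979].
-/

section Part7

open _root_.Complex _root_.Real _root_.MeasureTheory _root_.Set _root_.Filter _root_.Topology
open scoped _root_.NumberField nonZeroDivisors

namespace Literature.NumberTheory.LFunctions.NumberField.ClassPNT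

open Literature.NumberTheory.LFunctions Literature.NumberTheory.LFunctions.NumberField
  Literature.NumberTheory.LFunctions.EntireEF Literature.NumberTheory.LFunctions.TZWeight
  Literature.NumberTheory.LFunctions.AbelianDensity

/-- **The junk terms are `O(x^{1−ν})`**: for `Q ≥ 12`, `x ≥ Q^{a₁}` (`a₁ ≥ 32`), `0 < ν ≤ 1/64`, `h ≤ Q⁴`:
`A₀ x^{1−ν} + h (1152 e^{(log x)/4} + C_J) ≤ (A₀ + 1152 + C_J) x^{1−ν}` (`h ≤ Q⁴ ≤ x^{1/8}`). [cite: ThornerZaman2019, §§4–5 (core estimate for the smoothed class sums with the zero-free constant as parameter)] -/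
theorem junk_le_rpow {A₀ CJ h Q x ν a₁ : ℝ} (hCJ : 0 ≤ CJ) (hQ : 12 ≤ Q)
    (hh : h ≤ Q ^ 4) (hν : 0 < ν) (hν1 : ν ≤ 1 / 64) (hx : Q ^ a₁ ≤ x) (ha₁ : 32 ≤ a₁) :
    A₀ * x ^ (1 - ν) + h * (1152 * Real.exp (Real.log x / 4) + CJ) ≤ (A₀ + 1152 + CJ) * x ^ (1 - ν) := by
  have hQ0 : 0 < Q := by linarith
  have hQ1 : (1 : ℝ) ≤ Q := by linarith
  have hxQ : Q ≤ x := by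
    have := Real.rpow_le_rpow_of_exponent_le hQ1 (by linarith : (1 : ℝ) ≤ a₁)
    rw [Real.rpow_one] at this; exact this.trans hx
  have hx1 : (1 : ℝ) ≤ x := by linarith
  have hx0 : 0 < x := by linarith
  have hQ4 : Q ^ 4 ≤ x ^ ((1 : ℝ) / 8) := by
    have h1 : (Q ^ (4 : ℕ) : ℝ) = (Q ^ a₁) ^ ((4 : ℝ) / a₁) := by
      rw [← Real.rpow_mul hQ0.le, mul_div_cancel₀ _ (by linarith : a₁ ≠ 0)]
      norm_cast
    rw [h1]
    calc (Q ^ a₁) ^ ((4 : ℝ) / a₁) ≤ x ^ ((4 : ℝ) / a₁) :=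
          Real.rpow_le_rpow (Real.rpow_nonneg hQ0.le _) hx (by positivity)
      _ ≤ x ^ ((1 : ℝ) / 8) := by
          refine Real.rpow_le_rpow_of_exponent_le hx1 ?_
          rw [div_le_iff₀ (by linarith)]; linarith
  have hh' : h ≤ x ^ ((1 : ℝ) / 8) := hh.trans hQ4
  have hexp : Real.exp (Real.log x / 4) = x ^ ((1 : ℝ) / 4) := by
    rw [Real.rpow_def_of_pos hx0]; ring_nf
  have hpow1 : x ^ ((1 : ℝ) / 8) * x ^ ((1 : ℝ) / 4) ≤ x ^ (1 - ν) := by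
    rw [← Real.rpow_add hx0]
    exact Real.rpow_le_rpow_of_exponent_le hx1 (by linarith)
  have hpow2 : x ^ ((1 : ℝ) / 8) ≤ x ^ (1 - ν) := Real.rpow_le_rpow_of_exponent_le hx1 (by linarith)
  have hJ1 : h * (1152 * Real.exp (Real.log x / 4)) ≤ 1152 * x ^ (1 - ν) := by
    rw [hexp]
    calc h * (1152 * x ^ ((1 : ℝ) / 4)) ≤ x ^ ((1 : ℝ) / 8) * (1152 * x ^ ((1 : ℝ) / 4)) :=
          mul_le_mul_of_nonneg_right hh' (by positivity)
      _ = 1152 * (x ^ ((1 : ℝ) / 8) * x ^ ((1 : ℝ) / 4)) := by ring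
      _ ≤ 1152 * x ^ (1 - ν) := mul_le_mul_of_nonneg_left hpow1 (by norm_num)
  have hJ2 : h * CJ ≤ CJ * x ^ (1 - ν) := by
    calc h * CJ ≤ x ^ ((1 : ℝ) / 8) * CJ := mul_le_mul_of_nonneg_right hh' hCJ
      _ = CJ * x ^ ((1 : ℝ) / 8) := mul_comm _ _
      _ ≤ CJ * x ^ (1 - ν) := mul_le_mul_of_nonneg_left hpow2 hCJ
  rw [mul_add h]; nlinarith [hJ1, hJ2]

set_option maxHeartbeats 1600000 in
/-- **The core estimate for the smoothed class sums of the family, zero-free constant as a parameter**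
(see the module docstring). [cite: ThornerZaman2019, §4–5] [cite: LagariasMontgomeryOdlyzko1979, §7] -/
theorem smoothedClassSum_decay_core (n : ℕ) (hn : 1 < n) {b D a : ℝ} (hb : 0 < b) (hD : 0 < D)
    (ha : 1 ≤ a) :
    ∃ ν aC A₀ AJ : ℝ, 0 < ν ∧ ν ≤ 1 / 64 ∧ 32 ≤ aC ∧ 0 < A₀ ∧ 0 < AJ ∧
    ∀ (K : Type) [Field K] [NumberField K], Module.finrank ℚ K = n →
      (∀ (T : ℝ), 1 ≤ T → ∀ u : AddChar (Additive (ClassGroup (𝓞 K))) ℂ → Finset ℂ,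
        (∀ ψ, ∀ ρ ∈ u ψ, famF K ψ ρ = 0 ∧ 1 / 4 ≤ ρ.re ∧ ρ.re < 1 ∧ |ρ.im| ≤ T) →
        ∀ α : ℝ, α ≤ 1 →
          ∑ ψ, ∑ ρ ∈ u ψ with α ≤ ρ.re, (famMult K ψ ρ : ℝ) ≤
            D * Real.exp (b * (a * Real.log (ThornerZaman.condQn K) + Real.log (T + 4))) ^ (1 - α)) →
      ∀ (c : ℝ) (x : ℝ), ThornerZaman.condQn K ^ aC ≤ x →
      ∀ (Cl : ClassGroup (𝓞 K)) (Exc : AddChar (Additive (ClassGroup (𝓞 K))) ℂ → Finset ℂ),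
      (∀ ψ, ∀ ρ ∈ Exc ψ, famF K ψ ρ = 0 ∧ 0 < ρ.re ∧ ρ.re < 1) →
      (∀ ψ ρ, famF K ψ ρ = 0 → 0 < ρ.re → ρ.re < 1 → excRegion c K ρ → ρ ∈ Exc ψ) →
      ∀ cZ : ℝ, 0 < cZ →
      (∀ (ψ : AddChar (Additive (ClassGroup (𝓞 K))) ℂ) (ρ : ℂ), famF K ψ ρ = 0 → 1 / 4 ≤ ρ.re →
        ρ.re < 1 → |ρ.im| ≤ x → ¬ excRegion c K ρ →
          ρ.re ≤ 1 - cZ / (a * Real.log (ThornerZaman.condQn K) + Real.log (|ρ.im| + 4))) →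
      ‖(NumberField.classNumber K : ℂ) * (smoothedPsiClass K Cl (tzTest (Real.log x) (x ^ (-ν))) : ℂ) -
          fordLaplace (tzTest (Real.log x) (x ^ (-ν))) (-1) +
          ∑ ψ : AddChar (Additive (ClassGroup (𝓞 K))) ℂ, ψ (Additive.ofMul Cl⁻¹) *
            ∑ ρ ∈ Exc ψ, (famMult K ψ ρ : ℂ) * fordLaplace (tzTest (Real.log x) (x ^ (-ν))) (-ρ)‖ ≤
        x * (A₀ * (Real.exp (-(cZ * Real.log x / (4 * a * Real.log (ThornerZaman.condQn K)))) +
          Real.exp (-Real.sqrt (cZ * Real.log x / 4)))) + AJ * x ^ (1 - ν) := by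
  classical
  obtain ⟨ν, a₀, A₀, hν0, hν64, ha₀1, hA₀, hZ⟩ := fam_zeroSum_le_local_zfr n hn hb hD ha
  obtain ⟨Al, hAl0, hAl⟩ := exists_norm_logDeriv_classGroupLFunction_left_le
  obtain ⟨M, hM1, hM⟩ := TZWeight.exists_smoothTransition_deriv_bound
  have hlC := leftLineConst_nonneg
  set CJ : ℝ := 8 * leftLineConst * Al * ((n : ℝ) + 1) * M with hCJ
  have hM0 : 0 ≤ M := by linarith
  have hCJ0 : 0 ≤ CJ := by positivity
  set AJ : ℝ := A₀ + 1152 + CJ with hAJ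
  have hAJ0 : 0 < AJ := by rw [hAJ]; positivity
  set aC : ℝ := max a₀ 32 with haC
  have haCa₀ : a₀ ≤ aC := le_max_left _ _
  have haC32 : (32 : ℝ) ≤ aC := le_max_right _ _
  have haC1 : (1 : ℝ) ≤ aC := by linarith
  refine ⟨ν, aC, A₀, AJ, hν0, hν64, haC32, hA₀, hAJ0, fun K _ _ hKn hdens c x hx Cl Exc hExc hExc' cZ hcZ hzfr ↦ ?_⟩
  have hK : 1 < Module.finrank ℚ K := by rw [hKn]; exact hn
  set Q : ℝ := ThornerZaman.condQn K with hQ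
  have hQ12 : (12 : ℝ) ≤ Q := ThornerZaman.twelve_le_condQn (K := K) hK
  have hQ1 : (1 : ℝ) < Q := by linarith
  have hQ0 : (0 : ℝ) < Q := by linarith
  have hlogQ : 2 ≤ Real.log Q := two_lt_log_twelve.le.trans (Real.log_le_log (by norm_num) hQ12)
  have hhQ : (NumberField.classNumber K : ℝ) ≤ Q ^ 4 := by
    have := ThornerZaman.classNumber_le_condQn_pow (K := K) hK; rw [← hQ] at this; exact this
  have hxa₀ : Q ^ a₀ ≤ x := le_trans (Real.rpow_le_rpow_of_exponent_le hQ1.le haCa₀) hx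
  have hxQ : Q ≤ x := by
    have : Q ^ (1 : ℝ) ≤ Q ^ aC := Real.rpow_le_rpow_of_exponent_le hQ1.le haC1
    rw [Real.rpow_one] at this; linarith
  have hx1 : 1 < x := by linarith
  have hx0 : 0 < x := by linarith
  set L : ℝ := Real.log x with hL
  have hLQ : aC * Real.log Q ≤ L := by
    have := Real.log_le_log (by positivity) hx
    rwa [Real.log_rpow (by linarith)] at this
  have hL2a : 2 * aC ≤ L := by nlinarith
  have hL64 : 64 ≤ L := by nlinarith
  have hL0 : 0 < L := by linarith
  have hQexp : Q ≤ Real.exp (L / 8) := by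
    refine le_exp_of_log_le (by linarith) ?_
    rw [le_div_iff₀ (by norm_num)]; nlinarith
  set ε : ℝ := x ^ (-ν) with hε
  have hε0 : 0 < ε := Real.rpow_pos_of_pos hx0 _
  have hε1 : ε ≤ 1 := Real.rpow_le_one_of_one_le_of_nonpos hx1.le (by linarith)
  have hεL : ε < L / 2 := by linarith
  have hεexp : ε = Real.exp (-(ν * L)) := by
    rw [hε, Real.rpow_def_of_pos hx0, ← hL]; ring_nf
  have hBf := hZ c K hKn hdens x hxa₀ cZ hcZ hzfr ε le_rfl hε1
  have hM₀ : ∀ ψ : AddChar (Additive (ClassGroup (𝓞 K))) ℂ,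
      (famMult K ψ 0 : ℝ) * (L + ε) ≤ 1152 * Real.exp (L / 4) :=
    fun ψ ↦ famMult_zero_term_le hK ψ (by linarith) hε0.le hε1 hQexp
  have hJ0 : ‖dzEFRemainder K (tzTest L ε) 0‖ ≤ CJ := by
    have hJ := leftLine_term_le_one hAl0 hAl hM K hK hL0 hε0 hεL hε1 hν64 hεexp hQexp
    rw [hKn] at hJ; rw [hCJ]; exact hJ
  have hJ : ∀ ψ : AddChar (Additive (ClassGroup (𝓞 K))) ℂ, ψ ≠ 0 →
      ‖cgEFRemainder (toMulHom ψ).toHomUnits (tzTest L ε) 0‖ ≤ CJ := by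
    intro ψ hψ
    have hJ := leftLine_term_le hAl0 hAl hM K hK (toHomUnits_ne_one hψ) hL0 hε0 hεL hε1 hν64 hεexp hQexp
    rw [hKn] at hJ; rw [hCJ]; exact hJ
  have hest := norm_classNumber_mul_smoothedPsiClass_sub_le hx1 hε0 hεL Cl Exc hExc hExc' hBf hM₀ hJ0 hJ
  have hjunk : A₀ * x ^ (1 - ν) + (NumberField.classNumber K : ℝ) * (1152 * Real.exp (L / 4) + CJ) ≤
      AJ * x ^ (1 - ν) := junk_le_rpow hCJ0 hQ12 hhQ hν0 hν64 hx haC32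
  refine hest.trans ?_
  have e : A₀ * x * (Real.exp (-(cZ * Real.log x / (4 * a * Real.log (ThornerZaman.condQn K)))) +
      Real.exp (-Real.sqrt (cZ * Real.log x / 4))) + A₀ * x ^ (1 - ν) +
      (NumberField.classNumber K : ℝ) * (1152 * Real.exp (L / 4) + CJ) =
      x * (A₀ * (Real.exp (-(cZ * L / (4 * a * Real.log Q))) + Real.exp (-Real.sqrt (cZ * L / 4)))) +
      (A₀ * x ^ (1 - ν) + (NumberField.classNumber K : ℝ) * (1152 * Real.exp (L / 4) + CJ)) := by
    rw [hQ, hL]; ring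
  rw [e]
  linarith

end Literature.NumberTheory.LFunctions.NumberField.ClassPNT

end Part7

/-!
## Part 8 — port of `Summits/QuantumAdvantage/QuantumAdvantage/Theorems/LinnikCubicClassGroupsDegreeOnePrimesEscapeClassPNTDHInputs.lean` (3 declarations kept)

# The class prime number theorem with the Deuring–Heilbronn phenomenon, II: inputs

Small inputs for the Deuring–Heilbronn form of the smoothed class prime number theorem (file III):

* `Residue.one_sub_realZero_ge_condQn_rpow` — Stark's effective bound in `Q`-form: for `K` of degree
  `n > 1`, every real zero `β < 1` of a real class group character satisfies `c₁(n) Q^{−2} ≤ 1 − β`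
  (`Q = condQn K = |d_K| nⁿ`; from `classGroupLFunction_one_sub_realZero_ge'`);
* `classGroupLFunction_eq_zero_of_famF` — a zero `ρ ≠ 1` of `F_ψ` is a zero of `L(s, χ_ψ)`;
* `zfr_of_zeroRepulsion` — the Deuring–Heilbronn repulsion
  `log(1/(Cℒ(1−β₁)))/(Cℒ) ≤ 1 − Re ρ`, `ℒ = log|d_K| + n(log(|γ|+2)+1)`, put in the shape consumed by
  `fam_zeroSum_le_local_zfr`: every zero `ρ` of the family with `1/4 ≤ Re ρ < 1`, `|γ| ≤ x`, off the
  exceptional segment, has `Re ρ ≤ 1 − c_Z/(a log Q + log(|γ|+4))` with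
  `c_Z = min( log(1/(2Cn(1−β₁)log x))/(Cn), a log Q/2 )`, as long as `2Cn(1−β₁) log x ≤ 1/3`;
(The real-variable bookkeeping — absorption of powers of `Q` by `x^{−ν}`, the two regimes of `c_Z` — is in
`…ClassPNTDHNumerics.lean`.)

References: J. Thorner, A. Zaman, Algebra Number Theory 13 (2019), §5 (proof of Thm. 1.4)
[ThornerZaman2019]; J. C. Lagarias, H. L. Montgomery, A. M. Odlyzko, Invent. Math. 54 (1979), §§5–7
[LagariasMontgomeryOdlyzko1979]; H. M. Stark, Invent. Math. 23 (1974) [Stark1974].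
-/

section Part8

open _root_.Complex _root_.Real _root_.MeasureTheory _root_.Set _root_.Filter _root_.Topology
open scoped _root_.NumberField nonZeroDivisors

namespace Literature.NumberTheory.LFunctions.NumberField.ClassPNT

open Literature.NumberTheory.LFunctions Literature.NumberTheory.LFunctions.NumberField
  Literature.NumberTheory.LFunctions.EntireEF Literature.NumberTheory.LFunctions.TZWeight
  Literature.NumberTheory.LFunctions.AbelianDensity

/-! ### Stark's effective repulsion of the exceptional zero, `Q`-form -/

/-- **`1 − β ≥ c₁(n)·Q^{−2}` for every real zero of every real class group character** of a number field
of degree `n > 1` (`Q = condQn K`): the window-free effective bound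
`min(1/(8(2n)! log|d_K|), c|d_K|^{−1/n}(log|d_K|)^{−2}) ≤ 1 − β` of
`classGroupLFunction_one_sub_realZero_ge'` with `log|d_K| ≤ |d_K| ≤ Q`, `(log|d_K|)² ≤ 4|d_K|`,
`|d_K|^{−1/n} ≥ |d_K|^{−1}`.  [cite: Stark1974, §1, Theorem 1'] -/
theorem Residue.one_sub_realZero_ge_condQn_rpow (n : ℕ) (hn : 1 < n) :
    ∃ c₁ : ℝ, 0 < c₁ ∧ c₁ ≤ 1 ∧ ∀ (K : Type) [Field K] [NumberField K], Module.finrank ℚ K = n →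
      ∀ χ : ClassGroup (𝓞 K) →* ℂˣ, χ * χ = 1 → ∀ β : ℝ, β < 1 → classGroupLFunction K χ β = 0 →
        c₁ * ThornerZaman.condQn K ^ (-(2 : ℝ)) ≤ 1 - β := by
  obtain ⟨c, hc, h⟩ := classGroupLFunction_one_sub_realZero_ge'
  have hfac : (0 : ℝ) < ((2 * n).factorial : ℝ) := by exact_mod_cast Nat.factorial_pos _
  refine ⟨min (min (c / 4) (1 / (8 * ((2 * n).factorial : ℝ)))) 1,
    lt_min (lt_min (by positivity) (by positivity)) one_pos, min_le_right _ _,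
    fun K _ _ hKn χ hχ β hβ1 h0 => ?_⟩
  have hK : 1 < Module.finrank ℚ K := by rw [hKn]; exact hn
  have hmin := h K hK χ hχ β hβ1 h0
  rw [hKn] at hmin
  set Q : ℝ := ThornerZaman.condQn K with hQ
  have hQ12 : (12 : ℝ) ≤ Q := ThornerZaman.twelve_le_condQn (K := K) hK
  have hQ1 : (1 : ℝ) ≤ Q := by linarith
  set d : ℝ := ((NumberField.discr K).natAbs : ℝ) with hd
  have hd3 : (3 : ℝ) ≤ d := by
    have h2 := NumberField.abs_discr_gt_two hK
    rw [hd, Nat.cast_natAbs]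
    exact_mod_cast (show (3 : ℤ) ≤ |NumberField.discr K| by omega)
  have hd1 : (1 : ℝ) ≤ d := by linarith
  have hd0 : (0 : ℝ) < d := by linarith
  have hdQ : d ≤ Q := natAbs_discr_le_condQn K
  have hlogd0 : 0 < Real.log d := Real.log_pos (by linarith)
  have hlogd_le : Real.log d ≤ d := by
    have := Real.log_le_sub_one_of_pos hd0; linarith
  -- `(log d)² ≤ 4 d`
  have hlog2 : Real.log d ^ 2 ≤ 4 * d := by
    have h1 : Real.log d ≤ d ^ ((1 : ℝ) / 2) / (1 / 2) := Real.log_le_rpow_div hd0.le (by norm_num)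
    have h2 : Real.log d ≤ 2 * Real.sqrt d := by
      rw [Real.sqrt_eq_rpow]; linarith
    have h3 := Real.sq_sqrt hd0.le
    nlinarith [Real.sqrt_nonneg d]
  have hQ2 : Q ^ (-(2 : ℝ)) = 1 / Q ^ 2 := by
    rw [Real.rpow_neg (by linarith), ← Real.rpow_natCast]; norm_num
  -- (i) `c₁ Q^{-2} ≤ 1/(8 (2n)! log d)`
  have hi : min (min (c / 4) (1 / (8 * ((2 * n).factorial : ℝ)))) 1 * Q ^ (-(2 : ℝ)) ≤
      1 / (8 * ((2 * n).factorial : ℝ) * Real.log d) := by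
    rw [hQ2]
    have hle : min (min (c / 4) (1 / (8 * ((2 * n).factorial : ℝ)))) 1 ≤
        1 / (8 * ((2 * n).factorial : ℝ)) := (min_le_left _ _).trans (min_le_right _ _)
    have hlogQ2 : Real.log d ≤ Q ^ 2 := by nlinarith
    calc min (min (c / 4) (1 / (8 * ((2 * n).factorial : ℝ)))) 1 * (1 / Q ^ 2)
        ≤ 1 / (8 * ((2 * n).factorial : ℝ)) * (1 / Q ^ 2) :=
          mul_le_mul_of_nonneg_right hle (by positivity)
      _ = 1 / (8 * ((2 * n).factorial : ℝ) * Q ^ 2) := by rw [one_div_mul_one_div]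
      _ ≤ 1 / (8 * ((2 * n).factorial : ℝ) * Real.log d) := by
          refine one_div_le_one_div_of_le (by positivity) ?_
          exact mul_le_mul_of_nonneg_left hlogQ2 (by positivity)
  -- (ii) `c₁ Q^{-2} ≤ c d^{-1/n} / (log d)²`
  have hii : min (min (c / 4) (1 / (8 * ((2 * n).factorial : ℝ)))) 1 * Q ^ (-(2 : ℝ)) ≤
      c * d ^ (-(1 : ℝ) / n) / Real.log d ^ 2 := by
    rw [hQ2]
    have hle : min (min (c / 4) (1 / (8 * ((2 * n).factorial : ℝ)))) 1 ≤ c / 4 :=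
      (min_le_left _ _).trans (min_le_left _ _)
    have hn0 : (0 : ℝ) < n := by exact_mod_cast (lt_trans Nat.zero_lt_one hn)
    -- `d^{-1/n} ≥ d^{-1}`
    have hdn : d ^ (-(1 : ℝ)) ≤ d ^ (-(1 : ℝ) / n) := by
      refine Real.rpow_le_rpow_of_exponent_le hd1 ?_
      rw [neg_div, neg_le_neg_iff, div_le_one hn0]
      exact_mod_cast hn.le
    have hdinv : d ^ (-(1 : ℝ)) = 1 / d := by rw [Real.rpow_neg hd0.le, Real.rpow_one, one_div]
    calc min (min (c / 4) (1 / (8 * ((2 * n).factorial : ℝ)))) 1 * (1 / Q ^ 2)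
        ≤ c / 4 * (1 / Q ^ 2) := mul_le_mul_of_nonneg_right hle (by positivity)
      _ ≤ c / 4 * (1 / d ^ 2) := by
          refine mul_le_mul_of_nonneg_left ?_ (by positivity)
          exact one_div_le_one_div_of_le (by positivity) (by nlinarith)
      _ = c * (1 / d) / (4 * d) := by field_simp
      _ ≤ c * d ^ (-(1 : ℝ) / n) / (4 * d) := by
          rw [← hdinv]; gcongr
      _ ≤ c * d ^ (-(1 : ℝ) / n) / Real.log d ^ 2 := by
          refine div_le_div_of_nonneg_left (by positivity) (by positivity) hlog2
  exact (le_min hi hii).trans hmin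

/-! ### Zeros of the family are zeros of the `L`-functions -/

/-- A zero `ρ ≠ 1` of `F_ψ` (`= ζ₁_K` for `ψ = 0`, `L₀(·, χ_ψ)` otherwise) is a zero of `L(s, χ_ψ)`
(`= ζ_K` for `ψ = 0`). [cite: ThornerZaman2019, §5 proof of Thm. 1.4 (Deuring–Heilbronn repulsion fed into the zero sum; Stark in Q-form)] -/
theorem classGroupLFunction_eq_zero_of_famF {K : Type} [Field K] [NumberField K]
    (ψ : AddChar (Additive (ClassGroup (𝓞 K))) ℂ) {ρ : ℂ} (h0 : famF K ψ ρ = 0) (hρ1 : ρ ≠ 1) :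
    classGroupLFunction K (toMulHom ψ).toHomUnits ρ = 0 := by
  by_cases hψ : ψ = 0
  · subst hψ
    rw [famF_zero] at h0
    rw [toHomUnits_toMulHom_zero]
    by_contra hne
    exact ((dedekindZeta₁_ne_zero_iff (K := K) hρ1).2 hne) h0
  · rw [famF_of_ne hψ, classGroupLFunction₀_eq _ hρ1 (toHomUnits_ne_one hψ)] at h0
    exact h0

/-! ### The Deuring–Heilbronn repulsion in the shape of a zero-free region -/

/-- **Deuring–Heilbronn ⇒ zero-free region in `Q`-form.**  Let `K` have degree `n > 1`, `a ≥ 1`,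
`Q = condQn K ≤ x`, `log x ≥ 4`, and let `β₁` lie on the exceptional segment `excRegion c K` with
`2Cn(1 − β₁) log x ≤ 1/3`, `β₁ < 1`.  If every zero `ρ` of every `L(s, χ)` (`χ ∈ Ĉl_K`) with
`Re ρ ≥ 1/2`, `ρ ≠ 1, β₁` satisfies `log(1/(Cℒ_ρ(1−β₁)))/(Cℒ_ρ) ≤ 1 − Re ρ`
(`ℒ_ρ = log|d_K| + n(log(|Im ρ|+2)+1)`), then every zero `ρ` of every `F_ψ` with `1/4 ≤ Re ρ < 1`,
`|Im ρ| ≤ x`, off `excRegion c K`, satisfies `Re ρ ≤ 1 − c_Z/(a log Q + log(|Im ρ| + 4))`,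
`c_Z = min( log(1/(2Cn(1−β₁) log x))/(Cn), a log Q / 2 )`.
[cite: LagariasMontgomeryOdlyzko1979, Theorem 5.1] [cite: ThornerZaman2019, §5] -/
theorem zfr_of_zeroRepulsion {K : Type} [Field K] [NumberField K] {n : ℕ} (hn : 1 < n)
    (hKn : Module.finrank ℚ K = n) {C : ℝ} (hC : 0 < C) {β₁ c a x : ℝ} (ha : 1 ≤ a)
    (hexc₁ : excRegion c K (β₁ : ℂ)) (hβ1 : β₁ < 1) (hxQ : ThornerZaman.condQn K ≤ x)
    (hL4 : 4 ≤ Real.log x)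
    (hrep : ∀ (χ : ClassGroup (𝓞 K) →* ℂˣ) (ρ : ℂ), classGroupLFunction K χ ρ = 0 → 1 / 2 ≤ ρ.re →
      ρ ≠ 1 → ρ ≠ β₁ →
        Real.log (1 / (C * (Real.log ((NumberField.discr K).natAbs : ℝ) +
            Module.finrank ℚ K * (Real.log (|ρ.im| + 2) + 1)) * (1 - β₁))) /
          (C * (Real.log ((NumberField.discr K).natAbs : ℝ) +
            Module.finrank ℚ K * (Real.log (|ρ.im| + 2) + 1))) ≤ 1 - ρ.re)
    (hsmall : 2 * C * n * ((1 - β₁) * Real.log x) ≤ 1 / 3) :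
    ∀ (ψ : AddChar (Additive (ClassGroup (𝓞 K))) ℂ) (ρ : ℂ), famF K ψ ρ = 0 → 1 / 4 ≤ ρ.re →
      ρ.re < 1 → |ρ.im| ≤ x → ¬ excRegion c K ρ →
        ρ.re ≤ 1 - min (Real.log (1 / (2 * C * n * ((1 - β₁) * Real.log x))) / (C * n))
          (a * Real.log (ThornerZaman.condQn K) / 2) /
          (a * Real.log (ThornerZaman.condQn K) + Real.log (|ρ.im| + 4)) := by
  intro ψ ρ h0 _ hre1 hγ hexc
  have hK : 1 < Module.finrank ℚ K := by rw [hKn]; exact hn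
  set Q : ℝ := ThornerZaman.condQn K with hQ
  have hQ12 : (12 : ℝ) ≤ Q := ThornerZaman.twelve_le_condQn (K := K) hK
  have hlog12 : (2 : ℝ) ≤ Real.log 12 := by
    rw [Real.le_log_iff_exp_le (by norm_num)]
    have := Real.exp_one_lt_d9
    have h : Real.exp 2 = Real.exp 1 * Real.exp 1 := by rw [← Real.exp_add]; norm_num
    rw [h]; nlinarith [Real.exp_pos (1:ℝ)]
  have hlogQ : 2 ≤ Real.log Q := hlog12.trans (Real.log_le_log (by norm_num) hQ12)
  have hn2 : (2 : ℝ) ≤ n := by exact_mod_cast hn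
  have hx12 : (12 : ℝ) ≤ x := hQ12.trans hxQ
  have hx0 : 0 < x := by linarith
  set L : ℝ := Real.log x with hL
  set δ₁ : ℝ := 1 - β₁ with hδ₁
  have hδ₁0 : 0 < δ₁ := by rw [hδ₁]; linarith
  have hlog4 : 0 < Real.log (|ρ.im| + 4) := Real.log_pos (by linarith [abs_nonneg ρ.im])
  set Dn : ℝ := a * Real.log Q + Real.log (|ρ.im| + 4) with hDn
  have hDn0 : 0 < Dn := by rw [hDn]; nlinarith
  set cZ : ℝ := min (Real.log (1 / (2 * C * n * (δ₁ * L))) / (C * n)) (a * Real.log Q / 2) with hcZ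
  rcases lt_or_ge ρ.re (1 / 2) with hlt | hge
  · -- `Re ρ < 1/2`: `c_Z ≤ a log Q / 2 ≤ Dn / 2`
    have h1 : cZ / Dn ≤ 1 / 2 := by
      rw [div_le_iff₀ hDn0]
      have : cZ ≤ a * Real.log Q / 2 := min_le_right _ _
      rw [hDn]; nlinarith
    linarith
  · -- `Re ρ ≥ 1/2`: the repulsion
    have hρ1 : ρ ≠ 1 := by
      intro h; rw [h, Complex.one_re] at hre1; exact lt_irrefl _ hre1
    have hρβ : ρ ≠ (β₁ : ℂ) := by
      intro h; rw [h] at hexc; exact hexc hexc₁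
    have hLρ := classGroupLFunction_eq_zero_of_famF ψ h0 hρ1
    have key := hrep _ ρ hLρ hge hρ1 hρβ
    rw [hKn] at key
    set d : ℝ := ((NumberField.discr K).natAbs : ℝ) with hd
    have hd0 : (0 : ℝ) < d := by
      rw [hd]; exact_mod_cast Nat.pos_of_ne_zero (Int.natAbs_ne_zero.2 (NumberField.discr_ne_zero K))
    have hdQ : d ≤ Q := natAbs_discr_le_condQn K
    have hlogd0 : 0 ≤ Real.log d := by rw [hd]; exact Real.log_natCast_nonneg _
    have hlogdQ : Real.log d ≤ Real.log Q := Real.log_le_log hd0 hdQ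
    have hlogQL : Real.log Q ≤ L := Real.log_le_log (by linarith) hxQ
    have hlog2 : 0 < Real.log (|ρ.im| + 2) := Real.log_pos (by linarith [abs_nonneg ρ.im])
    set ℒ : ℝ := Real.log d + n * (Real.log (|ρ.im| + 2) + 1) with hℒ
    have hℒ0 : 0 < ℒ := by rw [hℒ]; positivity
    -- `ℒ ≤ 2 n L`
    have hlogx2 : Real.log (|ρ.im| + 2) ≤ L + 1 := by
      have h1 : Real.log (|ρ.im| + 2) ≤ Real.log (x + 2) :=
        Real.log_le_log (by linarith [abs_nonneg ρ.im]) (by linarith)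
      have h2 : x + 2 ≤ Real.exp 1 * x := by
        have := Real.exp_one_gt_d9; nlinarith
      have h3 : Real.log (x + 2) ≤ Real.log (Real.exp 1 * x) := Real.log_le_log (by linarith) h2
      rw [Real.log_mul (Real.exp_pos 1).ne' hx0.ne', Real.log_exp] at h3
      linarith
    have hℒL : ℒ ≤ 2 * n * L := by
      rw [hℒ]
      have h1 : (n : ℝ) * (Real.log (|ρ.im| + 2) + 1) ≤ n * (L + 2) := by
        refine mul_le_mul_of_nonneg_left ?_ (by linarith); linarith
      -- `log d + n (L + 2) ≤ L + nL + 2n ≤ 2nL` as `(n - 1) L ≥ 4 (n - 1) ≥ 2n`... with `L ≥ 4`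
      have h2 : ((n : ℝ) - 1) * 4 ≤ ((n : ℝ) - 1) * L := mul_le_mul_of_nonneg_left hL4 (by linarith)
      have h3 : Real.log d ≤ L := hlogdQ.trans hlogQL
      have e : (n : ℝ) * (L + 2) = n * L + 2 * n := by ring
      have e2 : 2 * (n : ℝ) * L = n * L + (((n : ℝ) - 1) * L + L) := by ring
      linarith
    -- `ℒ ≤ n Dn`
    have hℒD : ℒ ≤ n * Dn := by
      rw [hℒ, hDn]
      have h1 : Real.log (|ρ.im| + 2) ≤ Real.log (|ρ.im| + 4) :=
        Real.log_le_log (by linarith [abs_nonneg ρ.im]) (by linarith)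
      have h2 : Real.log d + n ≤ n * (a * Real.log Q) := by
        have h21 : Real.log Q ≤ a * Real.log Q := by nlinarith
        have h22 : (n : ℝ) * Real.log Q ≤ n * (a * Real.log Q) :=
          mul_le_mul_of_nonneg_left h21 (by linarith)
        -- `n log Q = log Q + (n - 1) log Q ≥ log d + 2 (n - 1) ≥ log d + n`
        have h23 : ((n : ℝ) - 1) * 2 ≤ ((n : ℝ) - 1) * Real.log Q :=
          mul_le_mul_of_nonneg_left hlogQ (by linarith)
        have h24 : (n : ℝ) * Real.log Q = Real.log Q + ((n : ℝ) - 1) * Real.log Q := by ring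
        linarith
      have h3 : (n : ℝ) * Real.log (|ρ.im| + 2) ≤ n * Real.log (|ρ.im| + 4) :=
        mul_le_mul_of_nonneg_left h1 (by linarith)
      have e : Real.log d + n * (Real.log (|ρ.im| + 2) + 1) =
          (Real.log d + n) + n * Real.log (|ρ.im| + 2) := by ring
      have e' : (n : ℝ) * (a * Real.log Q + Real.log (|ρ.im| + 4)) =
          n * (a * Real.log Q) + n * Real.log (|ρ.im| + 4) := by ring
      rw [e, e']
      linarith
    -- `t = C ℒ δ₁ ≤ 2 C n δ₁ L ≤ 1/3`
    set t : ℝ := C * ℒ * δ₁ with ht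
    have ht0 : 0 < t := by positivity
    have htle : t ≤ 2 * C * n * (δ₁ * L) := by
      rw [ht]
      have h1 : C * ℒ ≤ C * (2 * n * L) := mul_le_mul_of_nonneg_left hℒL hC.le
      have h2 : C * ℒ * δ₁ ≤ C * (2 * n * L) * δ₁ := mul_le_mul_of_nonneg_right h1 hδ₁0.le
      linarith
    have ht1 : t ≤ 1 / 3 := htle.trans hsmall
    have hsm0 : 0 < 2 * C * n * (δ₁ * L) := lt_of_lt_of_le ht0 htle
    -- `ℓ = log(1/(2Cnδ₁L)) ≤ log(1/t)`, `ℓ ≥ 0`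
    set ℓ : ℝ := Real.log (1 / (2 * C * n * (δ₁ * L))) with hℓ
    have hℓle : ℓ ≤ Real.log (1 / t) := by
      rw [hℓ]; exact Real.log_le_log (by positivity) (one_div_le_one_div_of_le ht0 htle)
    have hℓ0 : 0 ≤ ℓ := by
      rw [hℓ]; refine Real.log_nonneg ?_
      rw [le_div_iff₀ hsm0]; linarith
    have hlogt0 : 0 ≤ Real.log (1 / t) := hℓ0.trans hℓle
    -- the chain
    -- (`set` has rewritten `key` to `log(1/t)/(Cℒ) ≤ 1 − Re ρ`)
    have hkey' : Real.log (1 / t) / (C * ℒ) ≤ 1 - ρ.re := key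
    have h1 : cZ / Dn ≤ ℓ / (C * n) / Dn :=
      div_le_div_of_nonneg_right (min_le_left _ _) hDn0.le
    have h2 : ℓ / (C * n) / Dn = ℓ / (C * (n * Dn)) := by
      rw [div_div]; ring_nf
    have h3 : ℓ / (C * (n * Dn)) ≤ Real.log (1 / t) / (C * (n * Dn)) :=
      div_le_div_of_nonneg_right hℓle (by positivity)
    have h4 : Real.log (1 / t) / (C * (n * Dn)) ≤ Real.log (1 / t) / (C * ℒ) :=
      div_le_div_of_nonneg_left hlogt0 (by positivity) (mul_le_mul_of_nonneg_left hℒD hC.le)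
    have : cZ / Dn ≤ 1 - ρ.re := by
      calc cZ / Dn ≤ ℓ / (C * n) / Dn := h1
        _ = ℓ / (C * (n * Dn)) := h2
        _ ≤ Real.log (1 / t) / (C * (n * Dn)) := h3
        _ ≤ Real.log (1 / t) / (C * ℒ) := h4
        _ ≤ 1 - ρ.re := hkey'
    linarith

end Literature.NumberTheory.LFunctions.NumberField.ClassPNT

end Part8

/-!
## Part 9 — port of `Summits/QuantumAdvantage/QuantumAdvantage/Theorems/LinnikCubicClassGroupsDegreeOnePrimesEscapeClassPNTDHSmoothedDecayPrelims.lean` (3 declarations kept)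

# The class prime number theorem with DECAYING error, II′: the Landau–Page package in `Q`-form

Three small consequences of the Landau–Page package `exists_exceptionalZero_const` (TZ2019 Thm. 3.1 for the
class group `L`-functions of a number field `K`, constant `c₀ = c₀(n)`), isolated from the proof of
`smoothedClassSum_dichotomy_dh` (`…ClassPNTDHSmoothed.lean`) for reuse in its decaying-error twin
(`…ClassPNTDHSmoothedDecay.lean`); `c ≤ c₀` is the (narrower) constant of the exceptional segment
`excRegion c K`, `Q = condQn K = |d_K| n^n`:

* `zfr_classical_Qform` — off the segment every zero `ρ = β + iγ` of the family `F_ψ` has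
  `β ≤ 1 − c/(a log Q + log(|γ| + 4))` (`a ≥ 1`; clause (1): zeros in the region are real);
* `exceptionalZero_facts` — a zero `ρ₁` of `F_{ψ₁}` ON the segment (with `c ≤ 1/(8(n² + 1))`) is real,
  `ρ₁ = β₁ ≥ 1/2`, its character is real, it is simple (`m_{ψ₁}(ρ₁) = 1`) and `L(β₁, χ_{ψ₁}) = 0`;
* `excUpdate_spec` — by clause (2) (uniqueness) the sets `Exc = update (fun _ ↦ ∅) ψ₁ {ρ₁}` contain every
  zero of the family on the segment, and `Σ_ψ ψ(C⁻¹) Σ_{ρ ∈ Exc ψ} m_ψ(ρ) Φ(ρ) = ψ₁(C⁻¹) Φ(ρ₁)`.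

Reference: J. Thorner, A. Zaman, Algebra Number Theory 13 (2019), Thm. 3.1 [ThornerZaman2019].
-/

section Part9

open _root_.Complex _root_.Real _root_.MeasureTheory _root_.Set _root_.Filter _root_.Topology
open scoped _root_.NumberField nonZeroDivisors

namespace Literature.NumberTheory.LFunctions.NumberField.ClassPNT

open Literature.NumberTheory.LFunctions Literature.NumberTheory.LFunctions.NumberField
  Literature.NumberTheory.LFunctions.EntireEF Literature.NumberTheory.LFunctions.TZWeight
  Literature.NumberTheory.LFunctions.AbelianDensity

variable {K : Type} [Field K] [NumberField K]

/-- **The classical zero-free region off the exceptional segment, in `Q`-form**: with the reality clause of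
the Landau–Page package at `c₀` and `c ≤ c₀`, `a ≥ 1`, every zero `ρ` of `F_ψ` off `excRegion c K` has
`Re ρ ≤ 1 − c/(a log Q + log(|Im ρ| + 4))` (`log|d_K| ≤ log Q ≤ a log Q`). [cite: ThornerZaman2019, Theorem 3.1] -/
theorem zfr_classical_Qform {c c₀ a : ℝ} (hc : 0 < c) (hcc₀ : c ≤ c₀) (ha : 1 ≤ a)
    (hLPreal : ∀ (χ : ClassGroup (𝓞 K) →* ℂˣ) (ρ : ℂ),
      (((χ = 1 → dedekindZeta₁ K ρ = 0) ∧ (χ ≠ 1 → classGroupLFunction₀ K χ ρ = 0)) ∧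
        1 - c₀ / (Real.log ((NumberField.discr K).natAbs : ℝ) + Real.log (|ρ.im| + 4)) < ρ.re) →
        ρ.im = 0 ∧ χ * χ = 1)
    (ψ : AddChar (Additive (ClassGroup (𝓞 K))) ℂ) {ρ : ℂ} (h0 : famF K ψ ρ = 0)
    (hexc : ¬ excRegion c K ρ) :
    ρ.re ≤ 1 - c / (a * Real.log (ThornerZaman.condQn K) + Real.log (|ρ.im| + 4)) := by
  have hpack_c : ∀ (χ : ClassGroup (𝓞 K) →* ℂˣ) (ρ : ℂ),
      (((χ = 1 → dedekindZeta₁ K ρ = 0) ∧ (χ ≠ 1 → classGroupLFunction₀ K χ ρ = 0)) ∧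
        1 - c / (Real.log ((NumberField.discr K).natAbs : ℝ) + Real.log (|ρ.im| + 4)) < ρ.re) →
        ρ.im = 0 ∧ χ * χ = 1 :=
    fun χ ρ h ↦ hLPreal χ ρ ⟨h.1, lpRegion_mono hcc₀ h.2⟩
  have h1 := re_le_of_not_excRegion hpack_c ψ h0 hexc
  set Q : ℝ := ThornerZaman.condQn K with hQ
  have hd1 : (1 : ℝ) ≤ ((NumberField.discr K).natAbs : ℝ) := by
    exact_mod_cast Nat.one_le_iff_ne_zero.2 (Int.natAbs_ne_zero.2 (NumberField.discr_ne_zero K))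
  have hQ1 : (1 : ℝ) ≤ Q := hd1.trans (natAbs_discr_le_condQn K)
  have hlogQ : 0 ≤ Real.log Q := Real.log_nonneg hQ1
  have hdQ : Real.log ((NumberField.discr K).natAbs : ℝ) ≤ a * Real.log Q := by
    have hd0 : (0 : ℝ) < ((NumberField.discr K).natAbs : ℝ) := by
      exact_mod_cast Nat.pos_of_ne_zero (Int.natAbs_ne_zero.2 (NumberField.discr_ne_zero K))
    have h2 := Real.log_le_log hd0 (natAbs_discr_le_condQn K)
    rw [← hQ] at h2; nlinarith
  have hlog4 : 0 < Real.log (|ρ.im| + 4) := Real.log_pos (by linarith [abs_nonneg ρ.im])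
  have hlogd : 0 ≤ Real.log ((NumberField.discr K).natAbs : ℝ) := Real.log_natCast_nonneg _
  have : c / (a * Real.log Q + Real.log (|ρ.im| + 4)) ≤
      c / (Real.log ((NumberField.discr K).natAbs : ℝ) + Real.log (|ρ.im| + 4)) :=
    div_le_div_of_nonneg_left hc.le (by linarith) (by linarith)
  linarith

/-- **A zero of the family on the exceptional segment is real, simple, belongs to a real character and
is a zero of `L(s, χ)`**: with the reality and simplicity clauses of the Landau–Page package at `c₀`,
`c ≤ c₀`, `c ≤ 1/(8(n² + 1))`, a zero `ρ₁` of `F_{ψ₁}` with `Re ρ₁ < 1` on `excRegion c K`: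
`ρ₁ = β₁ := Re ρ₁`, `χ_{ψ₁}² = 1`, `m_{ψ₁}(ρ₁) = 1`, `1/2 ≤ β₁`, `L(β₁, χ_{ψ₁}) = 0`, and `β₁` lies on the
segment. [cite: ThornerZaman2019, Theorem 3.1] -/
theorem exceptionalZero_facts {n : ℕ} (hn : 1 < n) {c c₀ : ℝ} (hcc₀ : c ≤ c₀)
    (hcn : c ≤ 1 / (8 * ((n : ℝ) ^ 2 + 1)))
    (hLPreal : ∀ (χ : ClassGroup (𝓞 K) →* ℂˣ) (ρ : ℂ),
      (((χ = 1 → dedekindZeta₁ K ρ = 0) ∧ (χ ≠ 1 → classGroupLFunction₀ K χ ρ = 0)) ∧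
        1 - c₀ / (Real.log ((NumberField.discr K).natAbs : ℝ) + Real.log (|ρ.im| + 4)) < ρ.re) →
        ρ.im = 0 ∧ χ * χ = 1)
    (hLPsimple : ∀ (χ : ClassGroup (𝓞 K) →* ℂˣ) (ρ : ℂ),
      (((χ = 1 → dedekindZeta₁ K ρ = 0) ∧ (χ ≠ 1 → classGroupLFunction₀ K χ ρ = 0)) ∧
        1 - c₀ / (Real.log ((NumberField.discr K).natAbs : ℝ) + Real.log (|ρ.im| + 4)) < ρ.re) →
        (χ = 1 → analyticOrderAt (dedekindZeta₁ K) ρ = 1) ∧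
          (χ ≠ 1 → analyticOrderAt (classGroupLFunction₀ K χ) ρ = 1))
    (ψ₁ : AddChar (Additive (ClassGroup (𝓞 K))) ℂ) {ρ₁ : ℂ} (h0₁ : famF K ψ₁ ρ₁ = 0)
    (hre₁' : ρ₁.re < 1) (hexc₁ : excRegion c K ρ₁) :
    ρ₁ = ((ρ₁.re : ℝ) : ℂ) ∧ (toMulHom ψ₁).toHomUnits * (toMulHom ψ₁).toHomUnits = 1 ∧
      famMult K ψ₁ ρ₁ = 1 ∧ 1 / 2 ≤ ρ₁.re ∧
      classGroupLFunction K (toMulHom ψ₁).toHomUnits ρ₁.re = 0 ∧ excRegion c K ((ρ₁.re : ℝ) : ℂ) := by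
  have hn2 : (2 : ℝ) ≤ n := by exact_mod_cast hn
  have hZ₁ : (((toMulHom ψ₁).toHomUnits = 1 → dedekindZeta₁ K ρ₁ = 0) ∧
      ((toMulHom ψ₁).toHomUnits ≠ 1 → classGroupLFunction₀ K (toMulHom ψ₁).toHomUnits ρ₁ = 0)) ∧
      1 - c₀ / (Real.log ((NumberField.discr K).natAbs : ℝ) + Real.log (|ρ₁.im| + 4)) < ρ₁.re := by
    refine ⟨famZ_of_famF_eq_zero ψ₁ h0₁, lpRegion_mono hcc₀ ?_⟩
    obtain ⟨him, hre⟩ := hexc₁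
    rw [him, abs_zero, zero_add]; exact hre
  obtain ⟨him₁, hreal₁⟩ := hLPreal _ ρ₁ hZ₁
  have hρ₁ : ρ₁ = ((ρ₁.re : ℝ) : ℂ) := by
    apply Complex.ext <;> simp [him₁]
  have hmult : famMult K ψ₁ ρ₁ = 1 := by
    obtain ⟨hs1, hs2⟩ := hLPsimple _ ρ₁ hZ₁
    by_cases hψ : ψ₁ = 0
    · subst hψ
      have h := hs1 toHomUnits_toMulHom_zero
      have hne : analyticOrderAt (dedekindZeta₁ K) ρ₁ ≠ ⊤ := by rw [h]; exact ENat.one_ne_top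
      have : (analyticOrderNatAt (dedekindZeta₁ K) ρ₁ : ℕ∞) = 1 := by
        rw [Nat.cast_analyticOrderNatAt hne, h]
      rw [famMult, famF_zero]; exact_mod_cast this
    · have h := hs2 (toHomUnits_ne_one hψ)
      have hne : analyticOrderAt (classGroupLFunction₀ K (toMulHom ψ₁).toHomUnits) ρ₁ ≠ ⊤ := by
        rw [h]; exact ENat.one_ne_top
      have : (analyticOrderNatAt (classGroupLFunction₀ K (toMulHom ψ₁).toHomUnits) ρ₁ : ℕ∞) = 1 := by
        rw [Nat.cast_analyticOrderNatAt hne, h]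
      rw [famMult, famF_of_ne hψ]; exact_mod_cast this
  have hβhalf : 1 / 2 ≤ ρ₁.re := by
    have hlog4 : 1 < Real.log 4 := by
      rw [show (4:ℝ) = 2 ^ 2 by norm_num, Real.log_pow]; have := Real.log_two_gt_d9; push_cast; linarith
    have hlogd : 0 ≤ Real.log ((NumberField.discr K).natAbs : ℝ) := Real.log_natCast_nonneg _
    have hc2 : c ≤ 1 / 2 :=
      hcn.trans (by rw [div_le_div_iff_of_pos_left one_pos (by positivity) (by norm_num)]; nlinarith)
    have : c / (Real.log ((NumberField.discr K).natAbs : ℝ) + Real.log 4) ≤ 1 / 2 := by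
      rw [div_le_iff₀ (by linarith)]; nlinarith
    linarith [hexc₁.2]
  have hβ1ne : ((ρ₁.re : ℝ) : ℂ) ≠ 1 := by
    intro h'; apply hre₁'.ne; exact_mod_cast h'
  have h0β : famF K ψ₁ ((ρ₁.re : ℝ) : ℂ) = 0 := by rw [← hρ₁]; exact h0₁
  have hLzero : classGroupLFunction K (toMulHom ψ₁).toHomUnits ρ₁.re = 0 :=
    classGroupLFunction_eq_zero_of_famF ψ₁ h0β hβ1ne
  have hexcβ : excRegion c K ((ρ₁.re : ℝ) : ℂ) := by rw [← hρ₁]; exact hexc₁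
  exact ⟨hρ₁, hreal₁, hmult, hβhalf, hLzero, hexcβ⟩

/-- **The exceptional set is a singleton**: with the uniqueness clause of the Landau–Page package at `c₀`
and `c ≤ c₀`, for a zero `ρ₁` of `F_{ψ₁}` on `excRegion c K` with `0 < Re ρ₁ < 1` and `m_{ψ₁}(ρ₁) = 1`,
the sets `Exc = update (fun _ ↦ ∅) ψ₁ {ρ₁}` consist of non-trivial zeros, contain every zero of the family
on the segment, and `Σ_ψ ψ(C⁻¹) Σ_{ρ ∈ Exc ψ} m_ψ(ρ) Φ(ρ) = ψ₁(C⁻¹) Φ(ρ₁)`. [cite: ThornerZaman2019, Theorem 3.1] -/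
theorem excUpdate_spec {c c₀ : ℝ} (hcc₀ : c ≤ c₀)
    (hLPuniq : ∀ (χ₁ χ₂ : ClassGroup (𝓞 K) →* ℂˣ) (ρ₁ ρ₂ : ℂ),
      (((χ₁ = 1 → dedekindZeta₁ K ρ₁ = 0) ∧ (χ₁ ≠ 1 → classGroupLFunction₀ K χ₁ ρ₁ = 0)) ∧
        1 - c₀ / (Real.log ((NumberField.discr K).natAbs : ℝ) + Real.log (|ρ₁.im| + 4)) < ρ₁.re) →
      (((χ₂ = 1 → dedekindZeta₁ K ρ₂ = 0) ∧ (χ₂ ≠ 1 → classGroupLFunction₀ K χ₂ ρ₂ = 0)) ∧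
        1 - c₀ / (Real.log ((NumberField.discr K).natAbs : ℝ) + Real.log (|ρ₂.im| + 4)) < ρ₂.re) →
        χ₁ = χ₂ ∧ ρ₁ = ρ₂)
    (ψ₁ : AddChar (Additive (ClassGroup (𝓞 K))) ℂ) {ρ₁ : ℂ} (h0₁ : famF K ψ₁ ρ₁ = 0) (hre₁ : 0 < ρ₁.re)
    (hre₁' : ρ₁.re < 1) (hexc₁ : excRegion c K ρ₁) (hmult : famMult K ψ₁ ρ₁ = 1) :
    (∀ ψ, ∀ ρ ∈ Function.update (fun _ ↦ (∅ : Finset ℂ)) ψ₁ {ρ₁} ψ,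
        famF K ψ ρ = 0 ∧ 0 < ρ.re ∧ ρ.re < 1) ∧
    (∀ ψ ρ, famF K ψ ρ = 0 → 0 < ρ.re → ρ.re < 1 → excRegion c K ρ →
        ρ ∈ Function.update (fun _ ↦ (∅ : Finset ℂ)) ψ₁ {ρ₁} ψ) ∧
    ∀ (Cl : ClassGroup (𝓞 K)) (Φ : ℂ → ℂ),
      ∑ ψ : AddChar (Additive (ClassGroup (𝓞 K))) ℂ, ψ (Additive.ofMul Cl⁻¹) *
          ∑ ρ ∈ Function.update (fun _ ↦ (∅ : Finset ℂ)) ψ₁ {ρ₁} ψ, (famMult K ψ ρ : ℂ) * Φ ρ =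
        ψ₁ (Additive.ofMul Cl⁻¹) * Φ ρ₁ := by
  classical
  have hZ : ∀ ψ ρ, famF K ψ ρ = 0 → excRegion c K ρ →
      (((toMulHom ψ).toHomUnits = 1 → dedekindZeta₁ K ρ = 0) ∧
        ((toMulHom ψ).toHomUnits ≠ 1 → classGroupLFunction₀ K (toMulHom ψ).toHomUnits ρ = 0)) ∧
        1 - c₀ / (Real.log ((NumberField.discr K).natAbs : ℝ) + Real.log (|ρ.im| + 4)) < ρ.re := by
    intro ψ ρ h0 hexc
    refine ⟨famZ_of_famF_eq_zero ψ h0, lpRegion_mono hcc₀ ?_⟩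
    obtain ⟨him, hre⟩ := hexc
    rw [him, abs_zero, zero_add]; exact hre
  have hZ₁ := hZ ψ₁ ρ₁ h0₁ hexc₁
  refine ⟨?_, ?_, ?_⟩
  · intro ψ ρ hρ
    by_cases hψ : ψ = ψ₁
    · subst hψ
      rw [Function.update_self, Finset.mem_singleton] at hρ
      subst hρ; exact ⟨h0₁, hre₁, hre₁'⟩
    · rw [Function.update_of_ne hψ] at hρ; simp at hρ
  · intro ψ ρ h0 _ _ hexc
    obtain ⟨hχ, hρρ⟩ := hLPuniq _ _ ρ ρ₁ (hZ ψ ρ h0 hexc) hZ₁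
    have hψ : ψ = ψ₁ := toHomUnits_toMulHom_injective hχ
    subst hψ
    rw [Function.update_self, Finset.mem_singleton]; exact hρρ
  · intro Cl Φ
    rw [Finset.sum_eq_single ψ₁]
    · rw [Function.update_self, Finset.sum_singleton, hmult]; push_cast; ring
    · intro ψ _ hψ
      rw [Function.update_of_ne hψ, Finset.sum_empty, mul_zero]
    · intro h; exact absurd (Finset.mem_univ _) h

end Literature.NumberTheory.LFunctions.NumberField.ClassPNT

end Part9

/-!
## Part 10 — port of `Summits/QuantumAdvantage/QuantumAdvantage/Theorems/LinnikCubicClassGroupsDegreeOnePrimesEscapeClassPNTDHNumerics.lean` (1 declarations kept)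

# The class prime number theorem with the Deuring–Heilbronn phenomenon, II′: real-variable bookkeeping

Pure real-variable lemmas used by the Deuring–Heilbronn form of the smoothed class prime number theorem
(file III, `…ClassPNTDHSmoothed.lean`):

* `mul_rpow_neg_le_one_of_threshold` — `M Q^k x^{−ν} ≤ 1` once `x ≥ Q^{a}`, `aν ≥ k + max(0, log M)`;
* `dhRegime_zeroSum_small` — in the Deuring–Heilbronn regime `2Cn η₁ ≤ 1/3` (`η₁ = (1 − β₁) log x`),
  with `c_Z = min(log(1/(2Cnη₁))/(Cn), a log Q/2)`, the density-times-repulsion bound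
  `A₀ (e^{−c_Z L/(4a log Q)} + e^{−√(c_Z L/4)})` is `≤ (η/4) η₁` for `L ≥ a₁ log Q`, `a₁` large;
* `junk_small` — the trivial-zero, left-line and tail terms `A₀ x^{1−ν} + h(1152 x^{1/4} + C_J)` are
  `≤ (η/4) x · c₁ Q^{−2}` for `x ≥ Q^{a₁}`, `a₁` large.

Reference for the shape of the argument: J. Thorner, A. Zaman, Algebra Number Theory 13 (2019), §5
[ThornerZaman2019].
-/

section Part10

open _root_.Real

namespace Literature.NumberTheory.LFunctions.NumberField.ClassPNT

/-! ### Real-variable bookkeeping -/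

/-- **Absorption of a power of `Q` by `x^{−ν}`**: for `Q ≥ 12`, `x ≥ Q^{a}`, `ν > 0`, `M > 0`
and `a ν ≥ k + max(0, log M)`: `M · Q^k · x^{−ν} ≤ 1`. [cite: ThornerZaman2019, §5 (real-variable bookkeeping of the Deuring–Heilbronn regime)] -/
theorem mul_rpow_neg_le_one_of_threshold {Q x a ν k M : ℝ} (hQ : 12 ≤ Q) (hx : Q ^ a ≤ x)
    (hν : 0 < ν) (hM : 0 < M) (ha : k + max 0 (Real.log M) ≤ a * ν) :
    M * Q ^ k * x ^ (-ν) ≤ 1 := by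
  have hQ0 : 0 < Q := by linarith
  have hQ1 : (1 : ℝ) ≤ Q := by linarith
  have hQa : 0 < Q ^ a := Real.rpow_pos_of_pos hQ0 a
  have hlog12 : (1 : ℝ) ≤ Real.log 12 := by
    rw [Real.le_log_iff_exp_le (by norm_num)]
    have := Real.exp_one_lt_d9; linarith
  have hlogQ : 1 ≤ Real.log Q := hlog12.trans (Real.log_le_log (by norm_num) hQ)
  -- `x^{-ν} ≤ Q^{-aν}`
  have h1 : x ^ (-ν) ≤ (Q ^ a) ^ (-ν) := Real.rpow_le_rpow_of_nonpos hQa hx (by linarith)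
  rw [← Real.rpow_mul hQ0.le] at h1
  set m : ℝ := max 0 (Real.log M) with hm
  have hm0 : 0 ≤ m := le_max_left _ _
  have hmM : Real.log M ≤ m := le_max_right _ _
  -- `Q^k Q^{-aν} = Q^{-(aν - k)} ≤ Q^{-m} ≤ e^{-m} ≤ 1/M`
  have h2 : Q ^ k * Q ^ (a * -ν) = Q ^ (-(a * ν - k)) := by
    rw [← Real.rpow_add hQ0]; ring_nf
  have h3 : Q ^ (-(a * ν - k)) ≤ Q ^ (-m) := Real.rpow_le_rpow_of_exponent_le hQ1 (by linarith)
  have h4 : Q ^ (-m) ≤ Real.exp (-m) := by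
    rw [Real.rpow_def_of_pos hQ0, Real.exp_le_exp]; nlinarith
  have h5 : Real.exp (-m) ≤ 1 / M := by
    rw [Real.exp_neg, one_div]
    refine inv_anti₀ hM ?_
    calc M = Real.exp (Real.log M) := (Real.exp_log hM).symm
      _ ≤ Real.exp m := Real.exp_le_exp.2 hmM
  calc M * Q ^ k * x ^ (-ν) ≤ M * Q ^ k * Q ^ (a * -ν) :=
        mul_le_mul_of_nonneg_left h1 (by positivity)
    _ = M * (Q ^ k * Q ^ (a * -ν)) := by ring
    _ = M * Q ^ (-(a * ν - k)) := by rw [h2]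
    _ ≤ M * (1 / M) := mul_le_mul_of_nonneg_left ((h3.trans h4).trans h5) hM.le
    _ = 1 := by field_simp

/-! ### The junk terms -/

end Literature.NumberTheory.LFunctions.NumberField.ClassPNT

end Part10

/-!
## Part 11 — port of `Summits/QuantumAdvantage/QuantumAdvantage/Theorems/LinnikCubicClassGroupsDegreeOnePrimesEscapeClassPNTDecayNumerics.lean` (6 declarations kept)

# The class prime number theorem with DECAYING error, I: real-variable bookkeeping

Sequel of `…ClassPNTDHNumerics.lean`.  There the density-times-repulsion bound
`A₀ (e^{−c_Z L/(4a log Q)} + e^{−√(c_Z L/4)})` and the junk terms were absorbed into `η · x` for a FIXED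
`η > 0` at the price of a threshold `x ≥ Q^{a₁(η)}`.  Here the `x`-dependence is kept: every term is
bounded by a multiple of the Thorner–Zaman DECAY SHAPE

  `𝓓_κ(x) = e^{−κ log x / log Q} + e^{−√(κ log x)}`            (`κ > 0` depending on the degree only)

times, in the Deuring–Heilbronn regime, the relative size `η₁ = (1 − β₁) log x` of the main term — the
bookkeeping of [ThornerZaman2019, §5, proof of Thm. 5.1] ("`ψ_C(x) = (|C|/|G|) g(x) (1 + O(e^{−c log x/log Q}
+ e^{−(c log x)^{1/2}/n_K^{1/2}}))`").  Pure real-variable lemmas: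

* `decayShape_mono` — `𝓓_κ ≤ 𝓓_{κ'}` for `κ' ≤ κ`;
* `zeroSum_classical_decay` — with the classical zero-free constant `c`:
  `e^{−cL/(4a log Q)} + e^{−√(cL/4)} ≤ 𝓓_κ` for `κ ≤ c/(4a)`;
* `junk_decay`, `rpow_one_sub_decay`, `unsmoothing_decay` — the trivial-zero/left-line/tail terms, the
  powers `x^{1−ν}` and the unsmoothing error are `≤ const · x e^{−(ν/2) L} · c₁Q^{−2}` (resp. `ν/4`), hence
  below BOTH `x 𝓓_κ` and `x 𝓓_κ · (1 − β₁) log x` (Stark: `(1 − β₁) ≥ c₁ Q^{−2}`);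
* (sequel `…ClassPNTDecayNumericsDH.lean`: the Deuring–Heilbronn regime.)

Reference: J. Thorner, A. Zaman, *A unified and improved Chebotarev density theorem*, Algebra Number
Theory 13 (2019), §5 [ThornerZaman2019].
-/

section Part11

open _root_.Real

namespace Literature.NumberTheory.LFunctions.NumberField.ClassPNT

/-! ### The decay shape -/

/-- **Monotonicity of the decay shape in `κ`**: for `L ≥ 0`, `lQ > 0` and `κ' ≤ κ`,
`e^{−κL/lQ} + e^{−√(κL)} ≤ e^{−κ'L/lQ} + e^{−√(κ'L)}`. [cite: ThornerZaman2019, §5 proof of Thm. 5.1 (decay shape e^{−κ log x/log Q} + e^{−√(κ log x)}: real-variable bookkeeping)] -/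
theorem decayShape_mono {κ κ' L lQ : ℝ} (hL : 0 ≤ L) (hlQ : 0 < lQ) (hκ : κ' ≤ κ) :
    Real.exp (-(κ * L / lQ)) + Real.exp (-Real.sqrt (κ * L)) ≤
      Real.exp (-(κ' * L / lQ)) + Real.exp (-Real.sqrt (κ' * L)) := by
  refine add_le_add ?_ ?_
  · rw [Real.exp_le_exp, neg_le_neg_iff]
    exact div_le_div_of_nonneg_right (mul_le_mul_of_nonneg_right hκ hL) hlQ.le
  · rw [Real.exp_le_exp, neg_le_neg_iff]
    exact Real.sqrt_le_sqrt (mul_le_mul_of_nonneg_right hκ hL)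

/-- `e^{−κL} ≤ e^{−κL/lQ}` for `lQ ≥ 1`, `κ ≥ 0`, `L ≥ 0`. [cite: ThornerZaman2019, §5 proof of Thm. 5.1 (decay shape e^{−κ log x/log Q} + e^{−√(κ log x)}: real-variable bookkeeping)] -/
theorem exp_neg_mul_le_exp_neg_div {κ L lQ : ℝ} (hκ : 0 ≤ κ) (hL : 0 ≤ L) (hlQ : 1 ≤ lQ) :
    Real.exp (-(κ * L)) ≤ Real.exp (-(κ * L / lQ)) := by
  rw [Real.exp_le_exp, neg_le_neg_iff, div_le_iff₀ (by linarith)]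
  have : κ * L * 1 ≤ κ * L * lQ := mul_le_mul_of_nonneg_left hlQ (mul_nonneg hκ hL)
  linarith

/-- `e^{−κL} ≤ 𝓓_κ` (`lQ ≥ 1`, `κ, L ≥ 0`). [cite: ThornerZaman2019, §5 proof of Thm. 5.1 (decay shape e^{−κ log x/log Q} + e^{−√(κ log x)}: real-variable bookkeeping)] -/
theorem exp_neg_mul_le_decayShape {κ L lQ : ℝ} (hκ : 0 ≤ κ) (hL : 0 ≤ L) (hlQ : 1 ≤ lQ) :
    Real.exp (-(κ * L)) ≤ Real.exp (-(κ * L / lQ)) + Real.exp (-Real.sqrt (κ * L)) :=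
  (exp_neg_mul_le_exp_neg_div hκ hL hlQ).trans (le_add_of_nonneg_right (Real.exp_pos _).le)

/-- **The classical zero-sum bound is below the decay shape**: for `κ ≤ c/(4a)`, `a ≥ 1`, `c ≥ 0`,
`L ≥ 0`, `lQ > 0`: `e^{−cL/(4a lQ)} + e^{−√(cL/4)} ≤ e^{−κL/lQ} + e^{−√(κL)}`. [cite: ThornerZaman2019, §5 proof of Thm. 5.1 (decay shape e^{−κ log x/log Q} + e^{−√(κ log x)}: real-variable bookkeeping)] -/
theorem zeroSum_classical_decay {c a κ L lQ : ℝ} (hc : 0 ≤ c) (ha : 1 ≤ a) (hL : 0 ≤ L) (hlQ : 0 < lQ)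
    (hκ : κ ≤ c / (4 * a)) :
    Real.exp (-(c * L / (4 * a * lQ))) + Real.exp (-Real.sqrt (c * L / 4)) ≤
      Real.exp (-(κ * L / lQ)) + Real.exp (-Real.sqrt (κ * L)) := by
  have ha0 : 0 < a := by linarith
  have hκ' : κ ≤ c / 4 :=
    hκ.trans (div_le_div_of_nonneg_left hc (by norm_num) (by nlinarith))
  refine add_le_add ?_ ?_
  · rw [Real.exp_le_exp, neg_le_neg_iff]
    rw [show c * L / (4 * a * lQ) = c / (4 * a) * L / lQ by field_simp]
    exact div_le_div_of_nonneg_right (mul_le_mul_of_nonneg_right hκ hL) hlQ.le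
  · rw [Real.exp_le_exp, neg_le_neg_iff]
    refine Real.sqrt_le_sqrt ?_
    rw [show c * L / 4 = c / 4 * L by ring]
    exact mul_le_mul_of_nonneg_right hκ' hL

/-! ### The junk terms -/

/-- **The powers `x^{1−ν}` decay**: for `Q ≥ 12`, `x ≥ Q^{a}`, `0 < ν ≤ 1/2`, `c₁ > 0` and
`a ≥ (8 + 4 max(0, log(1/c₁)))/ν`: `x^{1−ν} ≤ x · e^{−(ν/4) log x} · c₁ Q^{−2}`. [cite: ThornerZaman2019, §5 proof of Thm. 5.1 (decay shape e^{−κ log x/log Q} + e^{−√(κ log x)}: real-variable bookkeeping)] -/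
theorem rpow_one_sub_decay {Q x ν c₁ a : ℝ} (hQ : 12 ≤ Q) (hx : Q ^ a ≤ x) (hν : 0 < ν) (hν2 : ν ≤ 1 / 2)
    (hc₁ : 0 < c₁) (ha : (8 + 4 * max 0 (Real.log (1 / c₁))) / ν ≤ a) :
    x ^ (1 - ν) ≤ x * Real.exp (-(ν / 4 * Real.log x)) * (c₁ * Q ^ (-(2 : ℝ))) := by
  have hQ0 : 0 < Q := by linarith
  have hQ1 : (1 : ℝ) ≤ Q := by linarith
  have hm0 : 0 ≤ max 0 (Real.log (1 / c₁)) := le_max_left _ _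
  have ha1 : (1 : ℝ) ≤ a := by
    have h16 : (16 : ℝ) ≤ (8 + 4 * max 0 (Real.log (1 / c₁))) / ν := by
      rw [le_div_iff₀ hν]; nlinarith
    linarith
  have hxQ : Q ≤ x := by
    have := Real.rpow_le_rpow_of_exponent_le hQ1 ha1
    rw [Real.rpow_one] at this; exact this.trans hx
  have hx1 : (1 : ℝ) ≤ x := by linarith
  have hx0 : 0 < x := by linarith
  -- threshold: `(1/c₁) Q² x^{-ν/4} ≤ 1`
  have hth := mul_rpow_neg_le_one_of_threshold (k := 2) (M := 1 / c₁) (ν := ν / 4) hQ hx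
    (by positivity) (by positivity) (by have := (div_le_iff₀ hν).1 ha; linarith)
  -- `x^{1-ν} ≤ x · x^{-ν/4} · x^{-ν/4}`
  have h1 : x ^ (1 - ν) ≤ x * x ^ (-(ν / 4)) * x ^ (-(ν / 4)) := by
    rw [mul_assoc, ← Real.rpow_add hx0, ← Real.rpow_one_add' hx0.le (by linarith)]
    exact Real.rpow_le_rpow_of_exponent_le hx1 (by linarith)
  have h2 : x ^ (-(ν / 4)) = Real.exp (-(ν / 4 * Real.log x)) := by
    rw [Real.rpow_def_of_pos hx0]; ring_nf
  have hQ2 : Q ^ (2 : ℝ) * Q ^ (-(2 : ℝ)) = 1 := by rw [← Real.rpow_add hQ0]; norm_num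
  have h3 : x ^ (-(ν / 4)) ≤ c₁ * Q ^ (-(2 : ℝ)) := by
    have hQm2 : 0 < Q ^ (-(2 : ℝ)) := Real.rpow_pos_of_pos hQ0 _
    have := mul_le_mul_of_nonneg_left hth (by positivity : (0 : ℝ) ≤ c₁ * Q ^ (-(2 : ℝ)))
    rw [mul_one] at this
    refine le_trans (le_of_eq ?_) this
    calc x ^ (-(ν / 4)) = x ^ (-(ν / 4)) * (Q ^ (2 : ℝ) * Q ^ (-(2 : ℝ))) := by rw [hQ2, mul_one]
      _ = c₁ * Q ^ (-(2 : ℝ)) * (1 / c₁ * Q ^ (2 : ℝ) * x ^ (-(ν / 4))) := by field_simp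
  calc x ^ (1 - ν) ≤ x * x ^ (-(ν / 4)) * x ^ (-(ν / 4)) := h1
    _ ≤ x * x ^ (-(ν / 4)) * (c₁ * Q ^ (-(2 : ℝ))) :=
        mul_le_mul_of_nonneg_left h3 (by positivity)
    _ = x * Real.exp (-(ν / 4 * Real.log x)) * (c₁ * Q ^ (-(2 : ℝ))) := by rw [h2]

/-- **The unsmoothing error decays**: for `Q ≥ 12`, `0 ≤ h ≤ Q⁴`, `x ≥ Q^{a}`, `0 < ν ≤ 1/2`, `c₁ > 0`,
`a ≥ (24 + 4 max(0, log(88(n+1)/(ν c₁))))/ν`: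
`n h (log x + 1)(8√x + 2x^{−ν}x + 1) ≤ (x e^{−(ν/4) log x}) · c₁ Q^{−2}`. [cite: ThornerZaman2019, §5 proof of Thm. 5.1 (decay shape e^{−κ log x/log Q} + e^{−√(κ log x)}: real-variable bookkeeping)] -/
theorem unsmoothing_decay {n h Q x ν c₁ a : ℝ} (hn : 0 ≤ n) (hh0 : 0 ≤ h) (hh : h ≤ Q ^ 4) (hQ : 12 ≤ Q)
    (hν : 0 < ν) (hν2 : ν ≤ 1 / 2) (hc₁ : 0 < c₁) (hx : Q ^ a ≤ x)
    (ha : (24 + 4 * max 0 (Real.log (88 * (n + 1) / (ν * c₁)))) / ν ≤ a) :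
    n * h * ((Real.log x + 1) * (8 * Real.sqrt x + 2 * x ^ (-ν) * x + 1)) ≤
      x * Real.exp (-(ν / 4 * Real.log x)) * (c₁ * Q ^ (-(2 : ℝ))) := by
  have hQ0 : 0 < Q := by linarith
  have hQ1 : (1 : ℝ) ≤ Q := by linarith
  have hm0 : 0 ≤ max 0 (Real.log (88 * (n + 1) / (ν * c₁))) := le_max_left _ _
  have ha1 : (1 : ℝ) ≤ a := by
    have h48 : (48 : ℝ) ≤ (24 + 4 * max 0 (Real.log (88 * (n + 1) / (ν * c₁)))) / ν := by
      rw [le_div_iff₀ hν]; nlinarith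
    linarith
  have hxQ : Q ≤ x := by
    have := Real.rpow_le_rpow_of_exponent_le hQ1 ha1
    rw [Real.rpow_one] at this; exact this.trans hx
  have hx1 : (1 : ℝ) < x := by linarith
  have hx0 : 0 < x := by linarith
  set L := Real.log x with hL
  have hlog12 : (1 : ℝ) ≤ Real.log 12 := by
    rw [Real.le_log_iff_exp_le (by norm_num)]
    have := Real.exp_one_lt_d9; linarith
  have hL1 : 1 ≤ L := hlog12.trans (Real.log_le_log (by norm_num) (by linarith))
  -- the bracket is `≤ 11 x^{1-ν}` and `log x + 1 ≤ 2 log x`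
  have hpow : x ^ (-ν) * x = x ^ (1 - ν) := by
    rw [sub_eq_add_neg, Real.rpow_add hx0, Real.rpow_one]; ring
  have hsqrt : Real.sqrt x ≤ x ^ (1 - ν) := by
    rw [Real.sqrt_eq_rpow]
    exact Real.rpow_le_rpow_of_exponent_le hx1.le (by linarith)
  have hone : (1 : ℝ) ≤ x ^ (1 - ν) := Real.one_le_rpow hx1.le (by linarith)
  have hbr : 8 * Real.sqrt x + 2 * x ^ (-ν) * x + 1 ≤ 11 * x ^ (1 - ν) := by
    rw [mul_assoc, hpow]; linarith
  have hP0 : 0 ≤ x ^ (1 - ν) := Real.rpow_nonneg hx0.le _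
  have h1 : n * h * ((L + 1) * (8 * Real.sqrt x + 2 * x ^ (-ν) * x + 1)) ≤
      22 * n * h * L * x ^ (1 - ν) := by
    have := mul_le_mul (by linarith : L + 1 ≤ 2 * L) hbr (by positivity) (by linarith)
    have := mul_le_mul_of_nonneg_left this (mul_nonneg hn hh0)
    linarith
  -- `L ≤ (4/ν) x^{ν/4}`
  have hLle : L ≤ x ^ (ν / 4) / (ν / 4) := Real.log_le_rpow_div hx0.le (by positivity)
  have h2 : 22 * n * h * L * x ^ (1 - ν) ≤ 88 * (n + 1) / ν * Q ^ 4 * (x ^ (ν / 4) * x ^ (1 - ν)) := by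
    have hA : n * h ≤ (n + 1) * Q ^ 4 := by nlinarith [mul_le_mul_of_nonneg_left hh hn, hQ0]
    have hB : L * x ^ (1 - ν) ≤ x ^ (ν / 4) / (ν / 4) * x ^ (1 - ν) :=
      mul_le_mul_of_nonneg_right hLle hP0
    have hC : 0 ≤ L * x ^ (1 - ν) := by positivity
    calc 22 * n * h * L * x ^ (1 - ν) = 22 * (n * h) * (L * x ^ (1 - ν)) := by ring
      _ ≤ 22 * ((n + 1) * Q ^ 4) * (x ^ (ν / 4) / (ν / 4) * x ^ (1 - ν)) :=
          mul_le_mul (mul_le_mul_of_nonneg_left hA (by norm_num)) hB hC (by positivity)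
      _ = 88 * (n + 1) / ν * Q ^ 4 * (x ^ (ν / 4) * x ^ (1 - ν)) := by field_simp; ring
  -- `x^{ν/4} x^{1-ν} = x · x^{-ν/4} · x^{-ν/2}`
  have h3 : x ^ (ν / 4) * x ^ (1 - ν) = x * x ^ (-(ν / 4)) * x ^ (-(ν / 2)) := by
    rw [← Real.rpow_add hx0, mul_assoc, ← Real.rpow_add hx0, ← Real.rpow_one_add' hx0.le (by linarith)]
    ring_nf
  -- threshold: `(88(n+1)/(ν c₁)) Q⁶ x^{-ν/2} ≤ 1`
  have hth := mul_rpow_neg_le_one_of_threshold (k := 6) (M := 88 * (n + 1) / (ν * c₁)) (ν := ν / 2)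
    hQ hx (by positivity) (by positivity) (by have := (div_le_iff₀ hν).1 ha; linarith)
  have hQ62 : Q ^ (6 : ℝ) * Q ^ (-(2 : ℝ)) = Q ^ 4 := by
    rw [← Real.rpow_add hQ0]; norm_num
  have h4 : 88 * (n + 1) / ν * Q ^ 4 * x ^ (-(ν / 2)) ≤ c₁ * Q ^ (-(2 : ℝ)) := by
    have hQm2 : 0 < Q ^ (-(2 : ℝ)) := Real.rpow_pos_of_pos hQ0 _
    have := mul_le_mul_of_nonneg_left hth (by positivity : (0 : ℝ) ≤ c₁ * Q ^ (-(2 : ℝ)))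
    rw [mul_one] at this
    refine le_trans (le_of_eq ?_) this
    rw [← hQ62]; field_simp
  have h5 : x ^ (-(ν / 4)) = Real.exp (-(ν / 4 * L)) := by
    rw [Real.rpow_def_of_pos hx0, ← hL]; ring_nf
  calc n * h * ((L + 1) * (8 * Real.sqrt x + 2 * x ^ (-ν) * x + 1))
      ≤ 22 * n * h * L * x ^ (1 - ν) := h1
    _ ≤ 88 * (n + 1) / ν * Q ^ 4 * (x ^ (ν / 4) * x ^ (1 - ν)) := h2
    _ = x * x ^ (-(ν / 4)) * (88 * (n + 1) / ν * Q ^ 4 * x ^ (-(ν / 2))) := by rw [h3]; ring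
    _ ≤ x * x ^ (-(ν / 4)) * (c₁ * Q ^ (-(2 : ℝ))) := mul_le_mul_of_nonneg_left h4 (by positivity)
    _ = x * Real.exp (-(ν / 4 * L)) * (c₁ * Q ^ (-(2 : ℝ))) := by rw [h5]

end Literature.NumberTheory.LFunctions.NumberField.ClassPNT

end Part11

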